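import Literature.MathematicalPhysics.QuantumFieldTheory.Balaban1983to89.B9Ineq363Vprime

/-!
# `Balaban1983to89.B9Ineq368Vprime` — B9 p. 403 (3.68)₃,₄ FOR THE CONCRETE `V′(A)` AND THE CONCRETE `G′(U′U)` OF (3.64):
# the remaining `G′(U′U)`-letters of the operator-form (3.68) chain — (3.65), (3.42)₃ for `G′(U′U)`, the bootstrap `V′G′(U′U)` —
# DISCHARGED, so that the kernel bounds of `P′(A)·D*`, `D·P′(A)·D*` rest on Theorem 3.1 for `G′(U)`, the (3.19)/(3.59)/
# (3.48)/(3.66)/(3.67) letters `Q′`, `Q′*`, `F′₂`, `F′₂*`, `C⁻¹`, `C⁻¹(U′U)`, `C′`, on (3.37) and on Lemma 2.1 of [4] only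

statement-level skeleton of published theorems with citation tags; proofs where landed; nothing here is a claim about the Yang–Mills mass gap

CITATION HEADER (lean-in-tree rule).  T. Bałaban, *Propagators for lattice gauge theories in a background field*, Commun.
Math. Phys. **99** (1985) 389–434 [Balaban1985BackgroundPropagators] (cell paper B9; `paper:balaban1985-cmp99-background-
propagators`, journal page = PDF page + 388): p. 403 [PDF 15] (3.68) and the sentence after it.  PRINT, VERBATIM (render
`…-p015-x2.png`; the transcription of this seat's gen-6/7 files `B9Ineq368PPrime` (l. 26–31) / `B9Ineq368PPrimeDs`, completed with
the first line «P(U′U) = P(U) + P′(A),» of the display (3.68), which that transcription skips):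
«These results imply that the operators R(U), P(U) = I − R(U) extend analytically to the domain (3.37) and satisfy the same
bounds, e.g. the operator P(U′U) satisfies the bounds (3.49). Moreover we have P(U′U) = P(U) + P′(A), |P′(A;x,x′)|,
|(DP′(A))_μ(x,x′)|, |(P′(A)D\*)_ν(x,x′)|, |(DP′(A)D\*)_{μν}(x,x′)| ≦ O(1)α₁[1, (Lʲη)⁻¹, (Lʲη)⁻¹, (Lʲη)⁻²](L^{j′}η)^{−d}
e^{−(1/2)δ₀d(y,y′)} for x ∈ Δ(y), y ∈ Λ_j, x′ ∈ Δ(y′), y′ ∈ Λ_{j′}. (3.68) The remainder can be written explicitly in terms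
of the operators introduced until now by writing the expansions of the operators determining P(U′U).»  This seat's CONDENSED
READING of that passage (a reading, NOT a quotation — see ERRATUM v1.2 below): P(U′U) = G′(U′U)Q′\*(U′U)(Q′(U′U)G′²(U′U)
Q′\*(U′U))⁻¹Q′(U′U)G′(U′U) (this is P = I − R of (3.25) p. 394 written at U′U) = P(U) + P′(A), the remainder P′(A) being explicit in
terms of G′(U), G′(U′U), V′, F′₂, C′ (the «operators introduced until now»: (3.57), (3.60), (3.64)/(3.65), (3.66)/(3.67)) and
obeying the four bounds of (3.68), i.e. |P′|, (Lʲη)|DP′|, (Lʲη)|P′D\*|, (Lʲη)²|DP′D\*| ≦ O(1)α₁(L^{j′}η)^{−d}e^{−(1/2)δ₀d(y,y′)};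
p. 402 [PDF 14]
(3.60)–(3.65) and «We assume that Theorem 3.1 is valid for the operator G′(U)»; p. 397 [PDF 9] (3.42); p. 398 [PDF 10] the
remarks («we may always replace ∇_U by ∇*_U», the scale convention); p. 396 [PDF 8] (3.37); [4] = T. Bałaban, *Propagators
and renormalization transformations for lattice gauge theories. II*, Commun. Math. Phys. **96** (1984) 223–250
[Balaban1984PropagatorsII], Lemma 2.1 p. 234, (2.51)–(2.55) p. 232, (2.66) p. 234; [B8] = T. Bałaban, *Spaces of regular
gauge field configurations on a lattice and gauge fixing conditions*, Commun. Math. Phys. **99** (1985) 75–102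
[Balaban1985RegularSpaces], (1.87) p. 91.  Cell `lit-balaban`, seat r06 (B9 fold owner) gen 9, fourth file; SKELETON rows
**B9.Eq3.68** × **B9.Thm3.4** × B9.Eq3.62 × B9.Eq3.60.  Continuation BY NAME of this seat's `B9Eq360VprimeLetters` (gen 9:
`ineq368_op_Ds_vPrime`, `ineq368_op_DDs_vPrime` = the (3.68)₃,₄ chain with the four `V′`-letter hypotheses discharged) and
`B9Ineq363Vprime` (gen 9: `ineq363_op_vPrime` = (3.63), `hasMajorant_vPrime_gpExt` = the bootstrap letter,
`gpExt_rightEntry_vPrime` = (3.42)₃ for `G′(U′U)`, `theta363`, `thetaL363`, `cVConc`), of p06/r06's `B9Eq360Vprime`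
(`gPrimeExtEnd` = the Neumann series (3.64) on the finite lattice, `eq365_end_left` = (3.65)₁, `opNorm_lt_one_of_363_261`,
`pPrime` = `P′(A)` of (3.68)) and, through them, of `B9Ineq368CommSum`/`B9Ineq368PPrimeDs`/`B9Ineq368PPrime` (gens 6–8).

WHY.  After `B9Eq360VprimeLetters` the (3.68)₃,₄ operator-form chain had, besides the Theorem-3.1/3.2-type one-letter inputs,
three hypotheses about the EXTENDED propagator `E = G′(U′U)`: the resolvent form `h365 : E = G′ + G′V′E`, the right entry
`hEDs : E·D* ≺ B_{E3}Lʲη e^{−δd}` and the bootstrap `hVE : V′E ≺ c_Vα₁B_Ee^{−δd}` (p. 403, verbatim: «The remainder can be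
written explicitly in terms of the operators introduced until now by writing the expansions of the operators determining
P(U′U).» — read by this seat as: in terms of G′(U), G′(U′U), V′, F′₂, C′).  With `B9Ineq363Vprime` all three are theorems
for the CONCRETE
`V′(A)` and the CONCRETE `G′(U′U) := G′(U)Σ_n(V′G′(U))ⁿ` of (3.64); this file plugs them in, at the rates the cell's Lemma-2.1
bookkeeping yields (`δ ↦ ρ₁ ↦ (1−3α′)ρ₁ ↦ ρ`), so that (3.68)₃,₄ for the concrete perturbation rest on inputs about `U` alone
(plus the (3.66)/(3.67) letters `C′`, `C⁻¹(U′U)` of the `(Q′G′²Q′*)⁻¹` clause, which stay letters here — HONEST SCOPE (i)).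

WHAT THIS FILE PROVES (0 sorry; one bookkeeping `def` with body + theorems; no `def … : Prop`).
* `rateC α′ ρ₁ := (1 − 3α′)ρ₁` — the common rate at which the `G′(U′U)`-letters are available.
* **`ineq368_op_Ds_conc`** — (3.68)₃ `P′(A)·D* ≺ κ₃₆₈ᴰ·α₁·(Lʲη)⁻¹·e^{−ρd}` for `P′(A) = pPrime G′ E Q′* Q′*(U′U) C⁻¹ C⁻¹(U′U) Q′
  Q′(U′U)` with `E := gPrimeExtEnd G′ (V′G′)` and `V′ = conj b (vPrimeConc …)`: `B9Eq360VprimeLetters.ineq368_op_Ds_vPrime`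
  at the rate `rateC α′ ρ₁` with `h365 := B9Eq360Vprime.eq365_end_left` (through (3.63) `ineq363_op_vPrime` and
  `opNorm_lt_one_of_363_261`), `hEDs := B9Ineq363Vprime.gpExt_rightEntry_vPrime`, `hVE := B9Ineq363Vprime.hasMajorant_vPrime_gpExt`
  (rate-weakened), the Theorem-3.1 entries of `G′(U)` and the `C`-letters rate-weakened from `δ`.
* **`ineq368_op_DDs_conc`** — the (3.68)₄ twin `D·P′(A)·D*` (left end letter `D₀`, entry `D₀G′(U) ≺ B_DLʲη e^{−δd}`).
* (v1.1) **`ineq368_op_conc`**, **`ineq368_op_D_conc`** — (3.68)₁ `P′(A) ≺ κ₃₆₈·α₁·e^{−ρd}` and (3.68)₂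
  `D·P′(A) ≺ κ₃₆₈·α₁·(Lʲη)⁻¹·e^{−ρd}` for the same concrete `V′(A)` and `G′(U′U)`: `B9Ineq368PPrime.ineq368_op`/`ineq368_op_D`
  (r06 gen 6, one-carrier letters) with `h365 := eq365_end_left`, `hE := gpExt_entry1_vPrime`, `hVE :=
  hasMajorant_vPrime_gpExt` DISCHARGED, at the rate `(1−α′)ρ₁` of the `E`-letters (no right entry needed: the last word is
  `G′Q′*C⁻¹Q′·(G′V′E)`), `c_V = κ₃₈₅(1, cVConc, 0, 0, Λ, c₁)`, `B_E = B₀c₁(1−θ₃₆₃c₁)⁻¹` — so that ALL FOUR ENTRIES of (3.68)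
  hold for the concrete perturbation.

HONEST SCOPE / NOT CLAIMED.  (i) The letters `Q′`, `Q′*`, `F′₂`, `F′₂*` (block-diagonal, (3.19)/(3.59)), `C⁻¹ = (Q′G′²Q′*)⁻¹(U)`
((3.48)), `C⁻¹(U′U)` and `C′` ((3.66)/(3.67), with `hCC : C⁻¹(U′U) − C⁻¹ = −C⁻¹(U′U)C′C⁻¹`) are the chain's abstract
endomorphisms of `S × ι → ℝ` with their printed-shape majorants as HYPOTHESES — the `(Q′G′²Q′*)⁻¹` clause of Theorem 3.4 is
`B9Ineq366CPrime.inverse_satisfies_thm32_of_parts` (two-space carrier; v1.1 note: for the concrete `V′` it is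
`B9Ineq366Vprime.inverse_satisfies_thm32_vPrime`, with GENUINE two-space letters `Q′ : sites → blocks` — the one-carrier
letters of the present chain are not derived from those); nor are they asserted to be conjugates of the kernels `kQ`, …
inside `V′` (as in `B9Eq360VprimeLetters`, HONEST SCOPE (ii)).
(ii) Theorem 3.1 for `G′(U)` enters through the entries `G′ ≺ B₀(Lʲη)²e^{−δd}`, `∇_kG′`, `G′∇_k ≺ B₀Lʲη e^{−δd}` per concrete
difference letter and `G′D* ≺ B₀Lʲη e^{−δd}` for the chosen right letter `D*`.  (iii) Rates and constants are the cell's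
bookkeeping, not the print's «O(1)» and «½δ₀»: inputs at `δ`, (3.63) at `ρ₁ ≦ δ − (α+β)δ₀`, the `G′(U′U)`-letters at
`(1−3α′)ρ₁`, output at `ρ` with `ρ + 2(2α+β)δ₀ ≦ (1−3α′)ρ₁`; two smallness conditions `θ₃₆₃c₁(ρ₁,α′) < 1`, `θ_Lc₁(ρ₁,α′) < 1`
(«for α₁ sufficiently small», both `θ`'s `= O(1)B₀α₁` with the `O(1)` explicit).  (iv) As before: finite-dimensional `𝔸`
with a real basis, transports `≦ ρu`, (3.37) blockwise, stencil geometry, `d(y,y) = 0`, symmetric `d`.  (v) Operator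
(block-majorant) form; the pointwise `(L^{j′}η)^{−d}` kernel form of (3.68) is not derived (located, as for gens 6–8).
Value = (3.68)₃,₄ (v1.1: all four entries of (3.68)) for the concrete perturbation with no hypothesis left about `G′(U′U)`;
NOT summit progress.

RELATED IN THE TREE, NOT DUPLICATED (searched 2026-08-21: `lean search 'ineq368_op_Ds_conc|rateC|ineq368_op_conc'` = ∅
apart from this file; `B9Ineq368PPrime(Ds)`/`B9Ineq368CommSum`/`B9Eq360VprimeLetters` are the chain with `E`-letters as hypotheses and are
USED here; `B9Ineq363Vprime` supplies the `E`-letters).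

ERRATUM v1.2 (docstring only; every declaration, statement and proof byte-identical to v1.1 p273268; referee
`lit-balaban-ref-1` gen 26, F1-minor, REFEREE.md Gen 26).  The v1/v1.1 CITATION HEADER displayed, between guillemets and
under the label «PRINT (render …)», the text «P(U′U) = G′(U′U)Q′\*(U′U)(…)⁻¹Q′(U′U)G′(U′U) = P(U) + P′(A), (3.68) The
remainder can be written explicitly in terms of the operators G′(U), G′(U′U), V′, F′₂, C′ and it satisfies the bounds
|P′(A;x,x′)|, |(Lʲη)(DP′)(A;x,x′)|, |(Lʲη)(P′D\*)(A;x,x′)|, |(Lʲη)²(DP′D\*)(A;x,x′)| ≦ O(1)α₁(L^{j′}η)^{−d}e^{−(1/2)δ₀d(y,y′)}».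
That text is a CONDENSED PARAPHRASE by this seat, not the print: p. 403 [PDF 15] (render `…-p015-x2.png`, re-read
2026-08-21 gen 10) prints only «P(U′U) = P(U) + P′(A),» followed by the four moduli with the bracket «O(1)α₁[1, (Lʲη)⁻¹,
(Lʲη)⁻¹, (Lʲη)⁻²](L^{j′}η)^{−d}e^{−(1/2)δ₀d(y,y′)} for x ∈ Δ(y), y ∈ Λ_j, x′ ∈ Δ(y′), y′ ∈ Λ_{j′}. (3.68)» and the sentence
«The remainder can be written explicitly in terms of the operators introduced until now by writing the expansions of the
operators determining P(U′U).»; the formula P = G′Q′\*(Q′G′²Q′\*)⁻¹Q′G′ is P = I − R of (3.25) p. 394 (written at U′U by this seat), the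
list «G′(U), G′(U′U), V′, F′₂, C′» is this seat's unpacking of «the operators introduced until now», and the (Lʲη)-weights
were moved inside the moduli by this seat.  v1.2 quotes the passage verbatim (= `B9Ineq368PPrime` l. 26–31 plus the display's first line) and
labels the condensed form as a READING; the WHY paragraph's partial quotation is corrected the same way.  Nothing that was
proved depended on the paraphrase: the theorems below take the (3.25)-shape of `P′(A)` from `B9Eq360Vprime.pPrime` /
`pPrime_explicit` (r06 gen 2, where (3.25)'s P at U′U and «= P(U) + P′(A)» are DEFINITIONS + an identity `eq368`), not from the
header.

DOCFIX v1.3 (r06 gen 16, 2026-08-22, DOC-ONLY; summit-lit1 CITELOC KNOWN-ROWED slip): [4] (2.66) is p. 234 (CMP 96, PDF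
p. 12: Lemma 2.1, (2.64)–(2.67)), not p. 235 — locators corrected (5 places); every declaration, statement and proof byte-identical to v1.2.
-/

noncomputable section

namespace Literature.MathematicalPhysics.QuantumFieldTheory.Balaban1983to89.B9Ineq368Vprime

open Literature.MathematicalPhysics.QuantumFieldTheory.Balaban1983to89
open Literature.MathematicalPhysics.QuantumFieldTheory.Balaban1983to89.B6RandomWalk (HasMajorant hasMajorant_mono
  Triangle254 Ineq261)
open Literature.MathematicalPhysics.QuantumFieldTheory.Balaban1983to89.B9Thm34Ext (toB6)
open Literature.MathematicalPhysics.QuantumFieldTheory.Balaban1983to89.B9Ineq347 (ScaleTransfer)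
open Literature.MathematicalPhysics.QuantumFieldTheory.Balaban1983to89.B9Eq39Adjoint (covD covDstar)
open Literature.MathematicalPhysics.QuantumFieldTheory.Balaban1983to89.B9Ineq385VG (kappa385 kappa385_nonneg)
open Literature.MathematicalPhysics.QuantumFieldTheory.Balaban1983to89.B9Ineq368PPrimeDs (kappa368Ds)
open Literature.MathematicalPhysics.QuantumFieldTheory.Balaban1983to89.B9Ineq368PPrime (kappa368 ineq368_op ineq368_op_D)
open Literature.MathematicalPhysics.QuantumFieldTheory.Balaban1983to89.B9Eq360Vprime (gPrimeExtEnd eq365_end_left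
  opNorm_lt_one_of_363_261)
open Literature.MathematicalPhysics.QuantumFieldTheory.Balaban1983to89.B9Eq352DivForm (tauB)
open Literature.MathematicalPhysics.QuantumFieldTheory.Balaban1983to89.B9Eq352DivFormLetters (conj)
open Literature.MathematicalPhysics.QuantumFieldTheory.Balaban1983to89.B9Eq352GradLetters (diffLetter)
open Literature.MathematicalPhysics.QuantumFieldTheory.Balaban1983to89.B9Eq360VprimeLetters (vPrimeConc cBConc cCConc
  ineq368_op_Ds_vPrime ineq368_op_DDs_vPrime)
open Literature.MathematicalPhysics.QuantumFieldTheory.Balaban1983to89.B9Ineq363Vprime (cVConc theta363 thetaL363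
  theta363_nonneg thetaL363_nonneg ineq363_op_vPrime hasMajorant_vPrime_gpExt gpExt_rightEntry_vPrime
  gpExt_entry1_vPrime cVConc_nonneg)

variable {𝔸 : Type*} [NormedRing 𝔸] [NormedAlgebra ℂ 𝔸] [CompleteSpace 𝔸] {ι : Type} [Fintype ι] [DecidableEq ι]
variable (b : Module.Basis ι ℝ 𝔸) {S : Type} [Fintype S] [DecidableEq S] {κ : Type} [Fintype κ]
variable (T : κ → Equiv.Perm S) (U : κ → S → 𝔸ˣ)
variable {g : B9.Geometry} [Fintype g.Site] [DecidableEq g.Site] {Rr : ℝ} {H : Prop}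

/-- The common rate at which the three `G′(U′U)`-letters of the chain are available from `B9Ineq363Vprime`: `(1 − 3α′)ρ₁`
(`ρ₁` the rate of (3.63), `α′` the exponent of the Neumann/left-fixed-point steps; the print's «δ₀(1 − O(1)α₁)» in the
cell's bookkeeping). [cite: Balaban1985BackgroundPropagators, p.403 l.1–9 + (3.68) p.403] -/
def rateC (α' ρ₁ : ℝ) : ℝ := (1 - 3 * α') * ρ₁

omit [Fintype g.Site] [DecidableEq g.Site] in
/-- Rate weakening `e^{−r d} ≦ e^{−ρ d}` for `ρ ≦ r`, `d ≧ 0`. [cite: Balaban1984PropagatorsII, (2.51) p.232] -/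
private theorem exp_rate_le {ρ r dd : ℝ} (h : ρ ≤ r) (hd : 0 ≤ dd) : Real.exp (-(r * dd)) ≤ Real.exp (-(ρ * dd)) :=
  Real.exp_le_exp.mpr (by nlinarith)

/-- **(3.68)₃ FOR THE CONCRETE `V′(A)` AND THE CONCRETE `G′(U′U)`** — «it satisfies the bounds … |(Lʲη)(P′D*)(A;x,x′)| ≦
O(1)α₁(L^{j′}η)^{−d}e^{−(1/2)δ₀d(y,y′)}» in the block-majorant form of [4] (2.51): with `V′ = conj b (vPrimeConc T U η A …)`,
`E := gPrimeExtEnd G′ (V′G′)` (the Neumann series (3.64) on the finite lattice) and `P′(A) = B9Eq360Vprime.pPrime G′ E Q′* Q′*′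
C⁻¹ C⁻¹′ Q′ Q′′`: `P′(A)·D* ≺ κ₃₆₈ᴰ·α₁·(Lʲη)⁻¹·e^{−ρd}` — `B9Eq360VprimeLetters.ineq368_op_Ds_vPrime` at the rate `rateC α′ ρ₁`
with its three `E`-letter hypotheses DISCHARGED: `h365` by `B9Eq360Vprime.eq365_end_left` (available since ‖V′G′‖ < 1 by
(3.63) = `B9Ineq363Vprime.ineq363_op_vPrime`), `hEDs` by `B9Ineq363Vprime.gpExt_rightEntry_vPrime` ((3.42)₃ for `G′(U′U)`),
`hVE` by `B9Ineq363Vprime.hasMajorant_vPrime_gpExt`.  INPUTS: Theorem 3.1 for `G′(U)` (entries `G′`, `∇_kG′`, `G′∇_k`, `G′D*`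
at rate `δ`), the letters `Q′`, `Q′*`, `F′₂`, `F′₂*`, `C⁻¹`, `C⁻¹(U′U)`, `C′` with their printed-shape majorants and the
algebra `h357`, `h357s`, `hCC`, the concrete-`V′` data ((3.37) blockwise, transports, stencil, averaging kernels), Lemma 2.1
of [4] (transfers at `α` incl. `Λ_ρ` at `(ρ₁, α′)`, (2.61) at `β` and at `(ρ₁, α′)`, (2.54)), rates `ρ₁ + (α+β)δ₀ ≦ δ`,
`ρ + 2(2α+β)δ₀ ≦ (1−3α′)ρ₁`, smallness `θ₃₆₃c₁ < 1`, `θ_Lc₁ < 1`.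
[cite: Balaban1985BackgroundPropagators, (3.68) p.403 + (3.60)–(3.65) pp.402–403 + (3.42) p.397 + p.398 (remarks) + (3.37) p.396 + Thm 3.4 p.400; Balaban1985RegularSpaces, (1.87) p.91; Balaban1984PropagatorsII, Lemma 2.1 p.234 + (2.51)–(2.55) p.232 + (2.66) p.234] -/
theorem ineq368_op_Ds_conc (blk : S → g.Site) (d : ℕ) {η : ℝ} (hη : 0 < η) (A : κ → S → 𝔸)
    (kQ kF : g.Site → S → 𝔸 →L[ℝ] 𝔸) (sQ sF : S → 𝔸 →L[ℝ] 𝔸) (c w : g.Site → ℝ) (ρu d₀ M₂ C a₀ : ℝ)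
    (δ₀ δ α β ρ₁ α' ρ Λ Λρ B₀ κQ cF κC Bc Bc' α₁ : ℝ)
    (hκQ : 0 ≤ κQ) (hcF : 0 ≤ cF) (hκC : 0 ≤ κC) (hBc : 0 ≤ Bc) (hBc' : 0 ≤ Bc') (hB₀ : 0 ≤ B₀) (hα₁ : 0 ≤ α₁)
    (hΛ : 1 ≤ Λ) (hΛρ : 0 ≤ Λρ) (hρ₁ : 0 ≤ ρ₁) (hρ : 0 ≤ ρ) (hα : 0 ≤ α) (hβ : 0 ≤ β) (hδ₀ : 0 ≤ δ₀) (hδ : 0 ≤ δ)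
    (hr1 : ρ₁ + (α + β) * δ₀ ≤ δ) (hα'1 : α' ≤ 1) (hα'0 : 0 ≤ α') (hα'ρ : 0 ≤ (1 - α') * ρ₁)
    (hα'ρ2 : 0 ≤ (1 - 2 * α') * ρ₁) (hα'ρ3 : 0 ≤ (1 - 3 * α') * ρ₁) (hr : ρ + 2 * ((2 * α + β) * δ₀) ≤ rateC α' ρ₁)
    (hdnn : ∀ a a' : g.Site, 0 ≤ g.dist a a') (hrefl : ∀ y : g.Site, g.dist y y = 0)
    (hsym : ∀ y y' : g.Site, g.dist y y' = g.dist y' y)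
    (htri : Triangle254 (toB6 g Rr H)) (hlen : ∀ y : g.Site, 0 < g.len y)
    (h261 : Ineq261 d (toB6 g Rr H) δ₀ β) (h261' : Ineq261 d (toB6 g Rr H) ρ₁ α')
    (hT1 : ScaleTransfer g δ₀ α Λ (fun a => g.len a)) (hT2 : ScaleTransfer g δ₀ α Λ (fun a => g.len a ^ 2))
    (hT1i : ScaleTransfer g δ₀ α Λ (fun a => (g.len a)⁻¹)) (hT2i : ScaleTransfer g δ₀ α Λ (fun a => (g.len a ^ 2)⁻¹))
    (hT4 : ScaleTransfer g δ₀ α Λ (fun a => (g.len a ^ 4)⁻¹)) (hTρ : ScaleTransfer g ρ₁ α' Λρ (fun a => g.len a))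
    -- the concrete `V′`-letters
    (hM₂ : 0 ≤ M₂) (hrepr : ∀ (v : 𝔸) (i : ι), |b.repr v i| ≤ M₂ * ‖v‖)
    (hsmall : ∀ y : g.Site, η * (α₁ * (g.len y)⁻¹) ≤ 1 / 4)
    (hA : ∀ μ x, ‖A μ x‖ ≤ α₁ * (g.len (blk x))⁻¹ ∧ ‖tauB T U μ (A μ) x‖ ≤ α₁ * (g.len (blk x))⁻¹)
    (h337s : ∀ μ x, ‖((η : ℂ)⁻¹) • covDstar T U μ (A μ) x‖ ≤ α₁ * (g.len (blk x) ^ 2)⁻¹)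
    (h337F : ∀ μ x, ‖((η : ℂ)⁻¹) • covD T U μ (A μ) x‖ ≤ α₁ * (g.len (blk x) ^ 2)⁻¹)
    (h337B : ∀ μ x, ‖((η : ℂ)⁻¹) • covDstar T U μ (tauB T U μ (A μ)) x‖ ≤ α₁ * (g.len (blk x) ^ 2)⁻¹)
    (hρu : ∀ μ x, ‖((U μ x : 𝔸ˣ) : 𝔸)‖ ≤ ρu ∧ ‖(((U μ x)⁻¹ : 𝔸ˣ) : 𝔸)‖ ≤ ρu)
    (hd₀ : ∀ μ x, g.dist (blk x) (blk (T μ x)) ≤ d₀ ∧ g.dist (blk x) (blk ((T μ).symm x)) ≤ d₀)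
    (hd₀0 : ∀ y : g.Site, g.dist y y ≤ d₀)
    (hw : ∀ y, 0 ≤ w y) (hcard : ∀ y, ((B9Eq360Vprime.block blk y).card : ℝ) * w y ≤ 1) (hC : 0 ≤ C) (ha₀ : 0 ≤ a₀)
    (hkQ : ∀ y x, blk x = y → ‖kQ y x‖ ≤ w y) (hkF : ∀ y x, blk x = y → ‖kF y x‖ ≤ C * α₁ * w y)
    (hsQ : ∀ x, ‖sQ x‖ ≤ 1) (hsF : ∀ x, ‖sF x‖ ≤ C * α₁) (hc : ∀ y, |c y| ≤ a₀ * (g.len y ^ 2)⁻¹)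
    -- the two smallness conditions («for α₁ sufficiently small»)
    (hθ : theta363 (Fintype.card κ) ρu α₁ a₀ C M₂ (∑ i, ‖b i‖) (Real.exp (δ * d₀)) B₀ Λ (B6.c1 d δ₀ β) *
      B6.c1 d ρ₁ α' < 1)
    (hθL : thetaL363 (Fintype.card κ) ρu α₁ a₀ C M₂ (∑ i, ‖b i‖) (Real.exp (δ * d₀)) B₀ Λ (B6.c1 d δ₀ β) *
      B6.c1 d ρ₁ α' < 1)
    -- Theorem 3.1 for `G′(U)` and the other letters of the chain
    {Gp Qs Q Qs' Q' F₂ F₂s Cinv Cinv' Cp Ds : Module.End ℝ (S × ι → ℝ)}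
    (h342_1 : HasMajorant (g := toB6 g Rr H) (fun p : S × ι => blk p.1) Gp
      (fun a a' => B₀ * g.len a ^ 2 * Real.exp (-(δ * g.dist a a'))))
    (h342_2 : ∀ k : κ ⊕ κ, HasMajorant (g := toB6 g Rr H) (fun p : S × ι => blk p.1)
      (conj b (diffLetter T U ((η : ℂ)⁻¹) k) * Gp) (fun a a' => B₀ * g.len a * Real.exp (-(δ * g.dist a a'))))
    (h342_3 : ∀ k : κ ⊕ κ, HasMajorant (g := toB6 g Rr H) (fun p : S × ι => blk p.1)
      (Gp * conj b (diffLetter T U ((η : ℂ)⁻¹) k)) (fun a a' => B₀ * g.len a * Real.exp (-(δ * g.dist a a'))))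
    (h342R : HasMajorant (g := toB6 g Rr H) (fun p : S × ι => blk p.1) (Gp * Ds)
      (fun a a' => B₀ * g.len a * Real.exp (-(δ * g.dist a a'))))
    (h357 : Q' = Q + F₂) (h357s : Qs' = Qs + F₂s) (hCC : Cinv' - Cinv = -(Cinv' * Cp * Cinv))
    (hQ : HasMajorant (g := toB6 g Rr H) (fun p : S × ι => blk p.1) Q (fun a a' : g.Site => if a = a' then κQ else 0))
    (hQs : HasMajorant (g := toB6 g Rr H) (fun p : S × ι => blk p.1) Qs (fun a a' : g.Site => if a = a' then κQ else 0))
    (hF : HasMajorant (g := toB6 g Rr H) (fun p : S × ι => blk p.1) F₂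
      (fun a a' : g.Site => if a = a' then cF * α₁ else 0))
    (hFs : HasMajorant (g := toB6 g Rr H) (fun p : S × ι => blk p.1) F₂s
      (fun a a' : g.Site => if a = a' then cF * α₁ else 0))
    (hCinv : HasMajorant (g := toB6 g Rr H) (fun p : S × ι => blk p.1) Cinv
      (fun a a' => Bc * (g.len a ^ 4)⁻¹ * Real.exp (-(δ * g.dist a a'))))
    (hCinv' : HasMajorant (g := toB6 g Rr H) (fun p : S × ι => blk p.1) Cinv'
      (fun a a' => Bc' * (g.len a ^ 4)⁻¹ * Real.exp (-(δ * g.dist a a'))))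
    (hCp : HasMajorant (g := toB6 g Rr H) (fun p : S × ι => blk p.1) Cp
      (fun a a' => κC * α₁ * g.len a ^ 4 * Real.exp (-(δ * g.dist a a')))) :
    let V := conj b (vPrimeConc T U η A blk kQ kF sQ sF c)
    let E := gPrimeExtEnd Gp (V * Gp)
    let θ := theta363 (Fintype.card κ) ρu α₁ a₀ C M₂ (∑ i, ‖b i‖) (Real.exp (δ * d₀)) B₀ Λ (B6.c1 d δ₀ β)
    let θL := thetaL363 (Fintype.card κ) ρu α₁ a₀ C M₂ (∑ i, ‖b i‖) (Real.exp (δ * d₀)) B₀ Λ (B6.c1 d δ₀ β)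
    let c' := B6.c1 d ρ₁ α'
    HasMajorant (g := toB6 g Rr H) (fun p : S × ι => blk p.1)
      (B9Eq360Vprime.pPrime Gp E Qs Qs' Cinv Cinv' Q Q' * Ds)
      (fun a a' => kappa368Ds κQ cF
          (kappa385 B₀ (cVConc (Fintype.card κ) ρu α₁ a₀ C M₂ (∑ i, ‖b i‖) (Real.exp (δ * d₀))) 0 0 Λ (B6.c1 d δ₀ β))
          κC B₀ B₀ B₀ (c' * (1 - θ * c')⁻¹) (B₀ * Λρ ^ 2 * c' * (1 - θL * c')⁻¹) Bc Bc'
          (cBConc (Fintype.card κ) M₂ (∑ i, ‖b i‖) (Real.exp (rateC α' ρ₁ * d₀)))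
          (cCConc (Fintype.card κ) ρu α₁ a₀ C M₂ (∑ i, ‖b i‖) (Real.exp (rateC α' ρ₁ * d₀))) Λ (B6.c1 d δ₀ β) α₁ *
        α₁ * (g.len a)⁻¹ * Real.exp (-(ρ * g.dist a a'))) := by
  intro V E θ θL c'
  have hSb : 0 ≤ ∑ i, ‖b i‖ := Finset.sum_nonneg fun i _ => norm_nonneg _
  have hθ0 : 0 ≤ θ := theta363_nonneg hα₁ ha₀ hC hM₂ hSb (Real.exp_nonneg _) hB₀ (zero_le_one.trans hΛ)
    (B6RandomWalk.c1_nonneg d δ₀ β)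
  have hθL0 : 0 ≤ θL := thetaL363_nonneg hα₁ ha₀ hC hM₂ hSb (Real.exp_nonneg _) hB₀ (zero_le_one.trans hΛ)
    (B6RandomWalk.c1_nonneg d δ₀ β)
  have hc'0 : 0 ≤ c' := B6RandomWalk.c1_nonneg d ρ₁ α'
  have hBE : 0 ≤ c' * (1 - θ * c')⁻¹ := mul_nonneg hc'0 (inv_nonneg.mpr (by linarith))
  have hBE3 : 0 ≤ B₀ * Λρ ^ 2 * c' * (1 - θL * c')⁻¹ :=
    mul_nonneg (by positivity) (inv_nonneg.mpr (by linarith))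
  have hcV : 0 ≤ kappa385 B₀ (cVConc (Fintype.card κ) ρu α₁ a₀ C M₂ (∑ i, ‖b i‖) (Real.exp (δ * d₀))) 0 0 Λ
      (B6.c1 d δ₀ β) :=
    kappa385_nonneg hB₀ (B9Ineq363Vprime.cVConc_nonneg hα₁ ha₀ hC hM₂ hSb (Real.exp_nonneg _)) le_rfl le_rfl
      (zero_le_one.trans hΛ) (B6RandomWalk.c1_nonneg d δ₀ β)
  -- rate bookkeeping: δc := (1 − 3α′)ρ₁ ≤ (1 − α′)ρ₁ ≤ ρ₁ ≤ δ
  have hρ₁δ : ρ₁ ≤ δ := by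
    have : 0 ≤ (α + β) * δ₀ := by positivity
    linarith
  have hδc0 : 0 ≤ rateC α' ρ₁ := by unfold rateC; exact hα'ρ3
  have hδc1 : rateC α' ρ₁ ≤ (1 - α') * ρ₁ := by unfold rateC; nlinarith
  have hδcδ : rateC α' ρ₁ ≤ δ := by unfold rateC at *; nlinarith
  -- (3.63) for the concrete V′ and the FIRST form of (3.65) for E
  have h363 : HasMajorant (g := toB6 g Rr H) (fun p : S × ι => blk p.1) (V * Gp)
      (fun a a' => θ * Real.exp (-(ρ₁ * g.dist a a'))) :=
    ineq363_op_vPrime b T U blk d hη A kQ kF sQ sF c w ρu d₀ M₂ C a₀ δ₀ δ α β ρ₁ Λ B₀ α₁ hB₀ hα₁ (zero_le_one.trans hΛ)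
      hρ₁ hα hβ hδ₀ hδ hr1 hdnn htri hlen h261 hT1 hT2 hM₂ hrepr hsmall hA h337s hρu hd₀ hd₀0 hw hcard hC ha₀ hkQ hkF hsQ
      hsF hc h342_1 h342_2
  have hW : ‖B9Eq360Vprime.toCLM (V * Gp)‖ < 1 :=
    opNorm_lt_one_of_363_261 (g := toB6 g Rr H) (fun p : S × ι => blk p.1) d ρ₁ α' θ hθ0 hα'ρ hdnn h261' hθ h363
  have h365 : E = Gp + Gp * V * E := eq365_end_left Gp V hW
  -- the two E-letters from `B9Ineq363Vprime`, rate-weakened to δc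
  have hVE : HasMajorant (g := toB6 g Rr H) (fun p : S × ι => blk p.1) (V * E)
      (fun a a' => kappa385 B₀ (cVConc (Fintype.card κ) ρu α₁ a₀ C M₂ (∑ i, ‖b i‖) (Real.exp (δ * d₀))) 0 0 Λ
        (B6.c1 d δ₀ β) * α₁ * (c' * (1 - θ * c')⁻¹) * Real.exp (-(rateC α' ρ₁ * g.dist a a'))) := by
    have h := hasMajorant_vPrime_gpExt b T U blk d hη A kQ kF sQ sF c w ρu d₀ M₂ C a₀ δ₀ δ α β ρ₁ Λ B₀ α₁ α' hB₀ hα₁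
      (zero_le_one.trans hΛ) hρ₁ hα hβ hδ₀ hδ hr1 hα'ρ hα'1 hdnn hrefl htri hlen h261 h261' hT1 hT2 hM₂ hrepr hsmall hA
      h337s hρu hd₀ hd₀0 hw hcard hC ha₀ hkQ hkF hsQ hsF hc hθ h342_1 h342_2
    refine hasMajorant_mono (g := toB6 g Rr H) _ h fun a a' => ?_
    have hθc : θ * c' * (1 - θ * c')⁻¹ = kappa385 B₀ (cVConc (Fintype.card κ) ρu α₁ a₀ C M₂ (∑ i, ‖b i‖)
        (Real.exp (δ * d₀))) 0 0 Λ (B6.c1 d δ₀ β) * α₁ * (c' * (1 - θ * c')⁻¹) := by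
      show theta363 _ _ _ _ _ _ _ _ _ _ _ * c' * (1 - θ * c')⁻¹ = _
      unfold theta363
      ring
    rw [show theta363 (Fintype.card κ) ρu α₁ a₀ C M₂ (∑ i, ‖b i‖) (Real.exp (δ * d₀)) B₀ Λ (B6.c1 d δ₀ β) = θ from rfl,
      show B6.c1 d ρ₁ α' = c' from rfl, hθc]
    exact mul_le_mul_of_nonneg_left (exp_rate_le hδc1 (hdnn a a')) (mul_nonneg (mul_nonneg hcV hα₁) hBE)
  have hEDs : HasMajorant (g := toB6 g Rr H) (fun p : S × ι => blk p.1) (E * Ds)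
      (fun a a' => B₀ * Λρ ^ 2 * c' * (1 - θL * c')⁻¹ * g.len a * Real.exp (-(rateC α' ρ₁ * g.dist a a'))) :=
    gpExt_rightEntry_vPrime b T U blk d hη A kQ kF sQ sF c w ρu d₀ M₂ C a₀ δ₀ δ α β ρ₁ Λ Λρ B₀ α₁ α' hB₀ hα₁
      (zero_le_one.trans hΛ) hΛρ hρ₁ hα hβ hδ₀ hδ hr1 hα'1 hα'ρ (mul_nonneg hα'0 hρ₁) hα'ρ2 hdnn hrefl hsym htri hlen h261
      h261' hT1 hT2 hT1i hT2i hTρ hM₂ hrepr hsmall hA h337s h337F h337B hρu hd₀ hd₀0 hw hcard hC ha₀ hkQ hkF hsQ hsF hc hθ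
      hθL h342_1 h342_2 h342_3 h342R
  -- Theorem 3.1 entries and the C-letters, rate-weakened from δ to δc
  have hG' : HasMajorant (g := toB6 g Rr H) (fun p : S × ι => blk p.1) Gp
      (fun a a' => B₀ * g.len a ^ 2 * Real.exp (-(rateC α' ρ₁ * g.dist a a'))) :=
    hasMajorant_mono (g := toB6 g Rr H) _ h342_1 fun a a' =>
      mul_le_mul_of_nonneg_left (exp_rate_le hδcδ (hdnn a a')) (mul_nonneg hB₀ (sq_nonneg _))
  have hGD' : ∀ k : κ ⊕ κ, HasMajorant (g := toB6 g Rr H) (fun p : S × ι => blk p.1)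
      (Gp * conj b (diffLetter T U ((η : ℂ)⁻¹) k)) (fun a a' => B₀ * g.len a * Real.exp (-(rateC α' ρ₁ * g.dist a a'))) :=
    fun k => hasMajorant_mono (g := toB6 g Rr H) _ (h342_3 k) fun a a' =>
      mul_le_mul_of_nonneg_left (exp_rate_le hδcδ (hdnn a a')) (mul_nonneg hB₀ (hlen a).le)
  have hCinv_c : HasMajorant (g := toB6 g Rr H) (fun p : S × ι => blk p.1) Cinv
      (fun a a' => Bc * (g.len a ^ 4)⁻¹ * Real.exp (-(rateC α' ρ₁ * g.dist a a'))) :=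
    hasMajorant_mono (g := toB6 g Rr H) _ hCinv fun a a' =>
      mul_le_mul_of_nonneg_left (exp_rate_le hδcδ (hdnn a a')) (mul_nonneg hBc (inv_nonneg.mpr (pow_nonneg (hlen a).le 4)))
  have hCinv'_c : HasMajorant (g := toB6 g Rr H) (fun p : S × ι => blk p.1) Cinv'
      (fun a a' => Bc' * (g.len a ^ 4)⁻¹ * Real.exp (-(rateC α' ρ₁ * g.dist a a'))) :=
    hasMajorant_mono (g := toB6 g Rr H) _ hCinv' fun a a' =>
      mul_le_mul_of_nonneg_left (exp_rate_le hδcδ (hdnn a a'))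
        (mul_nonneg hBc' (inv_nonneg.mpr (pow_nonneg (hlen a).le 4)))
  have hCp_c : HasMajorant (g := toB6 g Rr H) (fun p : S × ι => blk p.1) Cp
      (fun a a' => κC * α₁ * g.len a ^ 4 * Real.exp (-(rateC α' ρ₁ * g.dist a a'))) :=
    hasMajorant_mono (g := toB6 g Rr H) _ hCp fun a a' =>
      mul_le_mul_of_nonneg_left (exp_rate_le hδcδ (hdnn a a'))
        (mul_nonneg (mul_nonneg hκC hα₁) (pow_nonneg (hlen a).le 4))
  exact ineq368_op_Ds_vPrime b T U blk d hη A kQ kF sQ sF c w ρu d₀ M₂ C a₀ δ₀ (rateC α' ρ₁) α β ρ Λ κQ cF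
    (kappa385 B₀ (cVConc (Fintype.card κ) ρu α₁ a₀ C M₂ (∑ i, ‖b i‖) (Real.exp (δ * d₀))) 0 0 Λ (B6.c1 d δ₀ β)) κC B₀ B₀
    (c' * (1 - θ * c')⁻¹) (B₀ * Λρ ^ 2 * c' * (1 - θL * c')⁻¹) Bc Bc' α₁ hκQ hcF hcV hκC hB₀ hB₀ hBE hBE3 hBc hBc' hα₁ hΛ
    hρ hα hβ hδ₀ hδc0 hr hdnn htri hlen h261 hT1 hT1i hT2i hT4 hM₂ hrepr hsmall hA h337s h337F h337B hρu hd₀ hd₀0 hw hcard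
    hC ha₀ hkQ hkF hsQ hsF hc h357 h357s h365 hCC hG' hGD' hEDs hVE hQ hQs hF hFs hCinv_c hCinv'_c hCp_c

/-- **(3.68)₄ FOR THE CONCRETE `V′(A)` AND THE CONCRETE `G′(U′U)`** — «… |(Lʲη)²(DP′D*)(A;x,x′)| ≦
O(1)α₁(L^{j′}η)^{−d}e^{−(1/2)δ₀d(y,y′)}» in the block-majorant form of [4] (2.51), the twin of `ineq368_op_Ds_conc` with a left
end letter `D₀` (Theorem 3.1's left entry `D₀G′(U) ≺ B_DLʲη e^{−δd}`): with `V′ = conj b (vPrimeConc T U η A …)`,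
`E := gPrimeExtEnd G′ (V′G′)` (the Neumann series (3.64) on the finite lattice) and `P′(A) = B9Eq360Vprime.pPrime G′ E Q′* Q′*′
C⁻¹ C⁻¹′ Q′ Q′′`: `D₀·P′(A)·D* ≺ κ₃₆₈ᴰ·α₁·(Lʲη)⁻²·e^{−ρd}` — `B9Eq360VprimeLetters.ineq368_op_DDs_vPrime` at the rate `rateC α′ ρ₁`
with its three `E`-letter hypotheses DISCHARGED: `h365` by `B9Eq360Vprime.eq365_end_left` (available since ‖V′G′‖ < 1 by
(3.63) = `B9Ineq363Vprime.ineq363_op_vPrime`), `hEDs` by `B9Ineq363Vprime.gpExt_rightEntry_vPrime` ((3.42)₃ for `G′(U′U)`),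
`hVE` by `B9Ineq363Vprime.hasMajorant_vPrime_gpExt`.  INPUTS: Theorem 3.1 for `G′(U)` (entries `G′`, `∇_kG′`, `G′∇_k`, `G′D*`
at rate `δ`), the letters `Q′`, `Q′*`, `F′₂`, `F′₂*`, `C⁻¹`, `C⁻¹(U′U)`, `C′` with their printed-shape majorants and the
algebra `h357`, `h357s`, `hCC`, the concrete-`V′` data ((3.37) blockwise, transports, stencil, averaging kernels), Lemma 2.1
of [4] (transfers at `α` incl. `Λ_ρ` at `(ρ₁, α′)`, (2.61) at `β` and at `(ρ₁, α′)`, (2.54)), rates `ρ₁ + (α+β)δ₀ ≦ δ`,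
`ρ + 2(2α+β)δ₀ ≦ (1−3α′)ρ₁`, smallness `θ₃₆₃c₁ < 1`, `θ_Lc₁ < 1`.
[cite: Balaban1985BackgroundPropagators, (3.68) p.403 + (3.60)–(3.65) pp.402–403 + (3.42) p.397 + p.398 (remarks) + (3.37) p.396 + Thm 3.4 p.400; Balaban1985RegularSpaces, (1.87) p.91; Balaban1984PropagatorsII, Lemma 2.1 p.234 + (2.51)–(2.55) p.232 + (2.66) p.234] -/
theorem ineq368_op_DDs_conc (blk : S → g.Site) (d : ℕ) {η : ℝ} (hη : 0 < η) (A : κ → S → 𝔸)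
    (kQ kF : g.Site → S → 𝔸 →L[ℝ] 𝔸) (sQ sF : S → 𝔸 →L[ℝ] 𝔸) (c w : g.Site → ℝ) (ρu d₀ M₂ C a₀ : ℝ)
    (δ₀ δ α β ρ₁ α' ρ Λ Λρ B₀ BD κQ cF κC Bc Bc' α₁ : ℝ)
    (hκQ : 0 ≤ κQ) (hcF : 0 ≤ cF) (hκC : 0 ≤ κC) (hBc : 0 ≤ Bc) (hBc' : 0 ≤ Bc') (hB₀ : 0 ≤ B₀) (hBD : 0 ≤ BD)
    (hα₁ : 0 ≤ α₁)
    (hΛ : 1 ≤ Λ) (hΛρ : 0 ≤ Λρ) (hρ₁ : 0 ≤ ρ₁) (hρ : 0 ≤ ρ) (hα : 0 ≤ α) (hβ : 0 ≤ β) (hδ₀ : 0 ≤ δ₀) (hδ : 0 ≤ δ)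
    (hr1 : ρ₁ + (α + β) * δ₀ ≤ δ) (hα'1 : α' ≤ 1) (hα'0 : 0 ≤ α') (hα'ρ : 0 ≤ (1 - α') * ρ₁)
    (hα'ρ2 : 0 ≤ (1 - 2 * α') * ρ₁) (hα'ρ3 : 0 ≤ (1 - 3 * α') * ρ₁) (hr : ρ + 2 * ((2 * α + β) * δ₀) ≤ rateC α' ρ₁)
    (hdnn : ∀ a a' : g.Site, 0 ≤ g.dist a a') (hrefl : ∀ y : g.Site, g.dist y y = 0)
    (hsym : ∀ y y' : g.Site, g.dist y y' = g.dist y' y)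
    (htri : Triangle254 (toB6 g Rr H)) (hlen : ∀ y : g.Site, 0 < g.len y)
    (h261 : Ineq261 d (toB6 g Rr H) δ₀ β) (h261' : Ineq261 d (toB6 g Rr H) ρ₁ α')
    (hT1 : ScaleTransfer g δ₀ α Λ (fun a => g.len a)) (hT2 : ScaleTransfer g δ₀ α Λ (fun a => g.len a ^ 2))
    (hT1i : ScaleTransfer g δ₀ α Λ (fun a => (g.len a)⁻¹)) (hT2i : ScaleTransfer g δ₀ α Λ (fun a => (g.len a ^ 2)⁻¹))
    (hT4 : ScaleTransfer g δ₀ α Λ (fun a => (g.len a ^ 4)⁻¹)) (hTρ : ScaleTransfer g ρ₁ α' Λρ (fun a => g.len a))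
    -- the concrete `V′`-letters
    (hM₂ : 0 ≤ M₂) (hrepr : ∀ (v : 𝔸) (i : ι), |b.repr v i| ≤ M₂ * ‖v‖)
    (hsmall : ∀ y : g.Site, η * (α₁ * (g.len y)⁻¹) ≤ 1 / 4)
    (hA : ∀ μ x, ‖A μ x‖ ≤ α₁ * (g.len (blk x))⁻¹ ∧ ‖tauB T U μ (A μ) x‖ ≤ α₁ * (g.len (blk x))⁻¹)
    (h337s : ∀ μ x, ‖((η : ℂ)⁻¹) • covDstar T U μ (A μ) x‖ ≤ α₁ * (g.len (blk x) ^ 2)⁻¹)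
    (h337F : ∀ μ x, ‖((η : ℂ)⁻¹) • covD T U μ (A μ) x‖ ≤ α₁ * (g.len (blk x) ^ 2)⁻¹)
    (h337B : ∀ μ x, ‖((η : ℂ)⁻¹) • covDstar T U μ (tauB T U μ (A μ)) x‖ ≤ α₁ * (g.len (blk x) ^ 2)⁻¹)
    (hρu : ∀ μ x, ‖((U μ x : 𝔸ˣ) : 𝔸)‖ ≤ ρu ∧ ‖(((U μ x)⁻¹ : 𝔸ˣ) : 𝔸)‖ ≤ ρu)
    (hd₀ : ∀ μ x, g.dist (blk x) (blk (T μ x)) ≤ d₀ ∧ g.dist (blk x) (blk ((T μ).symm x)) ≤ d₀)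
    (hd₀0 : ∀ y : g.Site, g.dist y y ≤ d₀)
    (hw : ∀ y, 0 ≤ w y) (hcard : ∀ y, ((B9Eq360Vprime.block blk y).card : ℝ) * w y ≤ 1) (hC : 0 ≤ C) (ha₀ : 0 ≤ a₀)
    (hkQ : ∀ y x, blk x = y → ‖kQ y x‖ ≤ w y) (hkF : ∀ y x, blk x = y → ‖kF y x‖ ≤ C * α₁ * w y)
    (hsQ : ∀ x, ‖sQ x‖ ≤ 1) (hsF : ∀ x, ‖sF x‖ ≤ C * α₁) (hc : ∀ y, |c y| ≤ a₀ * (g.len y ^ 2)⁻¹)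
    -- the two smallness conditions («for α₁ sufficiently small»)
    (hθ : theta363 (Fintype.card κ) ρu α₁ a₀ C M₂ (∑ i, ‖b i‖) (Real.exp (δ * d₀)) B₀ Λ (B6.c1 d δ₀ β) *
      B6.c1 d ρ₁ α' < 1)
    (hθL : thetaL363 (Fintype.card κ) ρu α₁ a₀ C M₂ (∑ i, ‖b i‖) (Real.exp (δ * d₀)) B₀ Λ (B6.c1 d δ₀ β) *
      B6.c1 d ρ₁ α' < 1)
    -- Theorem 3.1 for `G′(U)` and the other letters of the chain
    {Gp D₀ Qs Q Qs' Q' F₂ F₂s Cinv Cinv' Cp Ds : Module.End ℝ (S × ι → ℝ)}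
    (h342_1 : HasMajorant (g := toB6 g Rr H) (fun p : S × ι => blk p.1) Gp
      (fun a a' => B₀ * g.len a ^ 2 * Real.exp (-(δ * g.dist a a'))))
    (h342_2 : ∀ k : κ ⊕ κ, HasMajorant (g := toB6 g Rr H) (fun p : S × ι => blk p.1)
      (conj b (diffLetter T U ((η : ℂ)⁻¹) k) * Gp) (fun a a' => B₀ * g.len a * Real.exp (-(δ * g.dist a a'))))
    (h342_3 : ∀ k : κ ⊕ κ, HasMajorant (g := toB6 g Rr H) (fun p : S × ι => blk p.1)
      (Gp * conj b (diffLetter T U ((η : ℂ)⁻¹) k)) (fun a a' => B₀ * g.len a * Real.exp (-(δ * g.dist a a'))))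
    (h342R : HasMajorant (g := toB6 g Rr H) (fun p : S × ι => blk p.1) (Gp * Ds)
      (fun a a' => B₀ * g.len a * Real.exp (-(δ * g.dist a a'))))
    (h342L : HasMajorant (g := toB6 g Rr H) (fun p : S × ι => blk p.1) (D₀ * Gp)
      (fun a a' => BD * g.len a * Real.exp (-(δ * g.dist a a'))))
    (h357 : Q' = Q + F₂) (h357s : Qs' = Qs + F₂s) (hCC : Cinv' - Cinv = -(Cinv' * Cp * Cinv))
    (hQ : HasMajorant (g := toB6 g Rr H) (fun p : S × ι => blk p.1) Q (fun a a' : g.Site => if a = a' then κQ else 0))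
    (hQs : HasMajorant (g := toB6 g Rr H) (fun p : S × ι => blk p.1) Qs (fun a a' : g.Site => if a = a' then κQ else 0))
    (hF : HasMajorant (g := toB6 g Rr H) (fun p : S × ι => blk p.1) F₂
      (fun a a' : g.Site => if a = a' then cF * α₁ else 0))
    (hFs : HasMajorant (g := toB6 g Rr H) (fun p : S × ι => blk p.1) F₂s
      (fun a a' : g.Site => if a = a' then cF * α₁ else 0))
    (hCinv : HasMajorant (g := toB6 g Rr H) (fun p : S × ι => blk p.1) Cinv
      (fun a a' => Bc * (g.len a ^ 4)⁻¹ * Real.exp (-(δ * g.dist a a'))))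
    (hCinv' : HasMajorant (g := toB6 g Rr H) (fun p : S × ι => blk p.1) Cinv'
      (fun a a' => Bc' * (g.len a ^ 4)⁻¹ * Real.exp (-(δ * g.dist a a'))))
    (hCp : HasMajorant (g := toB6 g Rr H) (fun p : S × ι => blk p.1) Cp
      (fun a a' => κC * α₁ * g.len a ^ 4 * Real.exp (-(δ * g.dist a a')))) :
    let V := conj b (vPrimeConc T U η A blk kQ kF sQ sF c)
    let E := gPrimeExtEnd Gp (V * Gp)
    let θ := theta363 (Fintype.card κ) ρu α₁ a₀ C M₂ (∑ i, ‖b i‖) (Real.exp (δ * d₀)) B₀ Λ (B6.c1 d δ₀ β)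
    let θL := thetaL363 (Fintype.card κ) ρu α₁ a₀ C M₂ (∑ i, ‖b i‖) (Real.exp (δ * d₀)) B₀ Λ (B6.c1 d δ₀ β)
    let c' := B6.c1 d ρ₁ α'
    HasMajorant (g := toB6 g Rr H) (fun p : S × ι => blk p.1)
      (D₀ * B9Eq360Vprime.pPrime Gp E Qs Qs' Cinv Cinv' Q Q' * Ds)
      (fun a a' => kappa368Ds κQ cF
          (kappa385 B₀ (cVConc (Fintype.card κ) ρu α₁ a₀ C M₂ (∑ i, ‖b i‖) (Real.exp (δ * d₀))) 0 0 Λ (B6.c1 d δ₀ β))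
          κC B₀ B₀ BD (c' * (1 - θ * c')⁻¹) (B₀ * Λρ ^ 2 * c' * (1 - θL * c')⁻¹) Bc Bc'
          (cBConc (Fintype.card κ) M₂ (∑ i, ‖b i‖) (Real.exp (rateC α' ρ₁ * d₀)))
          (cCConc (Fintype.card κ) ρu α₁ a₀ C M₂ (∑ i, ‖b i‖) (Real.exp (rateC α' ρ₁ * d₀))) Λ (B6.c1 d δ₀ β) α₁ *
        α₁ * (g.len a ^ 2)⁻¹ * Real.exp (-(ρ * g.dist a a'))) := by
  intro V E θ θL c'
  have hSb : 0 ≤ ∑ i, ‖b i‖ := Finset.sum_nonneg fun i _ => norm_nonneg _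
  have hθ0 : 0 ≤ θ := theta363_nonneg hα₁ ha₀ hC hM₂ hSb (Real.exp_nonneg _) hB₀ (zero_le_one.trans hΛ)
    (B6RandomWalk.c1_nonneg d δ₀ β)
  have hθL0 : 0 ≤ θL := thetaL363_nonneg hα₁ ha₀ hC hM₂ hSb (Real.exp_nonneg _) hB₀ (zero_le_one.trans hΛ)
    (B6RandomWalk.c1_nonneg d δ₀ β)
  have hc'0 : 0 ≤ c' := B6RandomWalk.c1_nonneg d ρ₁ α'
  have hBE : 0 ≤ c' * (1 - θ * c')⁻¹ := mul_nonneg hc'0 (inv_nonneg.mpr (by linarith))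
  have hBE3 : 0 ≤ B₀ * Λρ ^ 2 * c' * (1 - θL * c')⁻¹ :=
    mul_nonneg (by positivity) (inv_nonneg.mpr (by linarith))
  have hcV : 0 ≤ kappa385 B₀ (cVConc (Fintype.card κ) ρu α₁ a₀ C M₂ (∑ i, ‖b i‖) (Real.exp (δ * d₀))) 0 0 Λ
      (B6.c1 d δ₀ β) :=
    kappa385_nonneg hB₀ (B9Ineq363Vprime.cVConc_nonneg hα₁ ha₀ hC hM₂ hSb (Real.exp_nonneg _)) le_rfl le_rfl
      (zero_le_one.trans hΛ) (B6RandomWalk.c1_nonneg d δ₀ β)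
  -- rate bookkeeping: δc := (1 − 3α′)ρ₁ ≤ (1 − α′)ρ₁ ≤ ρ₁ ≤ δ
  have hρ₁δ : ρ₁ ≤ δ := by
    have : 0 ≤ (α + β) * δ₀ := by positivity
    linarith
  have hδc0 : 0 ≤ rateC α' ρ₁ := by unfold rateC; exact hα'ρ3
  have hδc1 : rateC α' ρ₁ ≤ (1 - α') * ρ₁ := by unfold rateC; nlinarith
  have hδcδ : rateC α' ρ₁ ≤ δ := by unfold rateC at *; nlinarith
  -- (3.63) for the concrete V′ and the FIRST form of (3.65) for E
  have h363 : HasMajorant (g := toB6 g Rr H) (fun p : S × ι => blk p.1) (V * Gp)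
      (fun a a' => θ * Real.exp (-(ρ₁ * g.dist a a'))) :=
    ineq363_op_vPrime b T U blk d hη A kQ kF sQ sF c w ρu d₀ M₂ C a₀ δ₀ δ α β ρ₁ Λ B₀ α₁ hB₀ hα₁ (zero_le_one.trans hΛ)
      hρ₁ hα hβ hδ₀ hδ hr1 hdnn htri hlen h261 hT1 hT2 hM₂ hrepr hsmall hA h337s hρu hd₀ hd₀0 hw hcard hC ha₀ hkQ hkF hsQ
      hsF hc h342_1 h342_2
  have hW : ‖B9Eq360Vprime.toCLM (V * Gp)‖ < 1 :=
    opNorm_lt_one_of_363_261 (g := toB6 g Rr H) (fun p : S × ι => blk p.1) d ρ₁ α' θ hθ0 hα'ρ hdnn h261' hθ h363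
  have h365 : E = Gp + Gp * V * E := eq365_end_left Gp V hW
  -- the two E-letters from `B9Ineq363Vprime`, rate-weakened to δc
  have hVE : HasMajorant (g := toB6 g Rr H) (fun p : S × ι => blk p.1) (V * E)
      (fun a a' => kappa385 B₀ (cVConc (Fintype.card κ) ρu α₁ a₀ C M₂ (∑ i, ‖b i‖) (Real.exp (δ * d₀))) 0 0 Λ
        (B6.c1 d δ₀ β) * α₁ * (c' * (1 - θ * c')⁻¹) * Real.exp (-(rateC α' ρ₁ * g.dist a a'))) := by
    have h := hasMajorant_vPrime_gpExt b T U blk d hη A kQ kF sQ sF c w ρu d₀ M₂ C a₀ δ₀ δ α β ρ₁ Λ B₀ α₁ α' hB₀ hα₁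
      (zero_le_one.trans hΛ) hρ₁ hα hβ hδ₀ hδ hr1 hα'ρ hα'1 hdnn hrefl htri hlen h261 h261' hT1 hT2 hM₂ hrepr hsmall hA
      h337s hρu hd₀ hd₀0 hw hcard hC ha₀ hkQ hkF hsQ hsF hc hθ h342_1 h342_2
    refine hasMajorant_mono (g := toB6 g Rr H) _ h fun a a' => ?_
    have hθc : θ * c' * (1 - θ * c')⁻¹ = kappa385 B₀ (cVConc (Fintype.card κ) ρu α₁ a₀ C M₂ (∑ i, ‖b i‖)
        (Real.exp (δ * d₀))) 0 0 Λ (B6.c1 d δ₀ β) * α₁ * (c' * (1 - θ * c')⁻¹) := by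
      show theta363 _ _ _ _ _ _ _ _ _ _ _ * c' * (1 - θ * c')⁻¹ = _
      unfold theta363
      ring
    rw [show theta363 (Fintype.card κ) ρu α₁ a₀ C M₂ (∑ i, ‖b i‖) (Real.exp (δ * d₀)) B₀ Λ (B6.c1 d δ₀ β) = θ from rfl,
      show B6.c1 d ρ₁ α' = c' from rfl, hθc]
    exact mul_le_mul_of_nonneg_left (exp_rate_le hδc1 (hdnn a a')) (mul_nonneg (mul_nonneg hcV hα₁) hBE)
  have hEDs : HasMajorant (g := toB6 g Rr H) (fun p : S × ι => blk p.1) (E * Ds)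
      (fun a a' => B₀ * Λρ ^ 2 * c' * (1 - θL * c')⁻¹ * g.len a * Real.exp (-(rateC α' ρ₁ * g.dist a a'))) :=
    gpExt_rightEntry_vPrime b T U blk d hη A kQ kF sQ sF c w ρu d₀ M₂ C a₀ δ₀ δ α β ρ₁ Λ Λρ B₀ α₁ α' hB₀ hα₁
      (zero_le_one.trans hΛ) hΛρ hρ₁ hα hβ hδ₀ hδ hr1 hα'1 hα'ρ (mul_nonneg hα'0 hρ₁) hα'ρ2 hdnn hrefl hsym htri hlen h261
      h261' hT1 hT2 hT1i hT2i hTρ hM₂ hrepr hsmall hA h337s h337F h337B hρu hd₀ hd₀0 hw hcard hC ha₀ hkQ hkF hsQ hsF hc hθ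
      hθL h342_1 h342_2 h342_3 h342R
  -- Theorem 3.1 entries and the C-letters, rate-weakened from δ to δc
  have hG' : HasMajorant (g := toB6 g Rr H) (fun p : S × ι => blk p.1) Gp
      (fun a a' => B₀ * g.len a ^ 2 * Real.exp (-(rateC α' ρ₁ * g.dist a a'))) :=
    hasMajorant_mono (g := toB6 g Rr H) _ h342_1 fun a a' =>
      mul_le_mul_of_nonneg_left (exp_rate_le hδcδ (hdnn a a')) (mul_nonneg hB₀ (sq_nonneg _))
  have hGD' : ∀ k : κ ⊕ κ, HasMajorant (g := toB6 g Rr H) (fun p : S × ι => blk p.1)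
      (Gp * conj b (diffLetter T U ((η : ℂ)⁻¹) k)) (fun a a' => B₀ * g.len a * Real.exp (-(rateC α' ρ₁ * g.dist a a'))) :=
    fun k => hasMajorant_mono (g := toB6 g Rr H) _ (h342_3 k) fun a a' =>
      mul_le_mul_of_nonneg_left (exp_rate_le hδcδ (hdnn a a')) (mul_nonneg hB₀ (hlen a).le)
  have hDG' : HasMajorant (g := toB6 g Rr H) (fun p : S × ι => blk p.1) (D₀ * Gp)
      (fun a a' => BD * g.len a * Real.exp (-(rateC α' ρ₁ * g.dist a a'))) :=
    hasMajorant_mono (g := toB6 g Rr H) _ h342L fun a a' =>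
      mul_le_mul_of_nonneg_left (exp_rate_le hδcδ (hdnn a a')) (mul_nonneg hBD (hlen a).le)
  have hCinv_c : HasMajorant (g := toB6 g Rr H) (fun p : S × ι => blk p.1) Cinv
      (fun a a' => Bc * (g.len a ^ 4)⁻¹ * Real.exp (-(rateC α' ρ₁ * g.dist a a'))) :=
    hasMajorant_mono (g := toB6 g Rr H) _ hCinv fun a a' =>
      mul_le_mul_of_nonneg_left (exp_rate_le hδcδ (hdnn a a')) (mul_nonneg hBc (inv_nonneg.mpr (pow_nonneg (hlen a).le 4)))
  have hCinv'_c : HasMajorant (g := toB6 g Rr H) (fun p : S × ι => blk p.1) Cinv'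
      (fun a a' => Bc' * (g.len a ^ 4)⁻¹ * Real.exp (-(rateC α' ρ₁ * g.dist a a'))) :=
    hasMajorant_mono (g := toB6 g Rr H) _ hCinv' fun a a' =>
      mul_le_mul_of_nonneg_left (exp_rate_le hδcδ (hdnn a a'))
        (mul_nonneg hBc' (inv_nonneg.mpr (pow_nonneg (hlen a).le 4)))
  have hCp_c : HasMajorant (g := toB6 g Rr H) (fun p : S × ι => blk p.1) Cp
      (fun a a' => κC * α₁ * g.len a ^ 4 * Real.exp (-(rateC α' ρ₁ * g.dist a a'))) :=
    hasMajorant_mono (g := toB6 g Rr H) _ hCp fun a a' =>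
      mul_le_mul_of_nonneg_left (exp_rate_le hδcδ (hdnn a a'))
        (mul_nonneg (mul_nonneg hκC hα₁) (pow_nonneg (hlen a).le 4))
  exact ineq368_op_DDs_vPrime b T U blk d hη A kQ kF sQ sF c w ρu d₀ M₂ C a₀ δ₀ (rateC α' ρ₁) α β ρ Λ κQ cF
    (kappa385 B₀ (cVConc (Fintype.card κ) ρu α₁ a₀ C M₂ (∑ i, ‖b i‖) (Real.exp (δ * d₀))) 0 0 Λ (B6.c1 d δ₀ β)) κC B₀ B₀
    BD (c' * (1 - θ * c')⁻¹) (B₀ * Λρ ^ 2 * c' * (1 - θL * c')⁻¹) Bc Bc' α₁ hκQ hcF hcV hκC hB₀ hB₀ hBD hBE hBE3 hBc hBc'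
    hα₁ hΛ hρ hα hβ hδ₀ hδc0 hr hdnn htri hlen h261 hT1 hT1i hT2i hT4 hM₂ hrepr hsmall hA h337s h337F h337B hρu hd₀ hd₀0 hw
    hcard hC ha₀ hkQ hkF hsQ hsF hc h357 h357s h365 hCC hG' hDG' hGD' hEDs hVE hQ hQs hF hFs hCinv_c hCinv'_c hCp_c

/-! ## (v1.1) (3.68)₁,₂ for the concrete `V′(A)` and the concrete `G′(U′U)` — all four entries of (3.68) -/

/-- **(3.68)₁ FOR THE CONCRETE `V′(A)` AND THE CONCRETE `G′(U′U)`** — «Moreover we have P(U′U) = P(U) + P′(A), |P′(A;x,x′)| ≦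
O(1)α₁(L^{j′}η)^{−d}e^{−(1/2)δ₀d(y,y′)}» in the block-majorant form of [4] (2.51): with `V′ = conj b (vPrimeConc T U η A …)`,
`E := gPrimeExtEnd G′ (V′G′)` (3.64) and `P′(A) = B9Eq360Vprime.pPrime G′ E Q′* Q′*′ C⁻¹ C⁻¹′ Q′ Q′′`:
`P′(A) ≺ κ₃₆₈·α₁·e^{−ρd}` — `B9Ineq368PPrime.ineq368_op` at the rate `(1−α′)ρ₁` with `h365 := B9Eq360Vprime.eq365_end_left`
(‖V′G′‖ < 1 by (3.63) = `ineq363_op_vPrime`), `hE := gpExt_entry1_vPrime` ((3.42)₁ for `G′(U′U)`, `B_E = B₀c₁(1−θc₁)⁻¹`),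
`hVE := hasMajorant_vPrime_gpExt` (`c_V = κ₃₈₅(1, cVConc, 0, 0, Λ, c₁)`) DISCHARGED.  INPUTS: Theorem 3.1 (3.42)₁,₂ for `G′(U)`
at rate `δ`, the letters `Q′`, `Q′*`, `F′₂`, `F′₂*`, `C⁻¹`, `C⁻¹(U′U)`, `C′` with printed-shape majorants and the algebra
`h357`, `h357s`, `hCC`, the concrete-`V′` data, Lemma 2.1 of [4] (transfers of `Lʲη`, `(Lʲη)²`, `(Lʲη)⁻⁴` at `α`, (2.61)
at `β` and at `(ρ₁, α′)`), rates `ρ₁ + (α+β)δ₀ ≦ δ`, `ρ + 2(2α+β)δ₀ ≦ (1−α′)ρ₁`, smallness `θ₃₆₃c₁(α′) < 1`.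
[cite: Balaban1985BackgroundPropagators, (3.68) p.403 + (3.60)–(3.65) pp.402–403 + (3.42) p.397 + (3.37) p.396 + Thm 3.4 p.400; Balaban1984PropagatorsII, Lemma 2.1 p.234 + (2.51)–(2.55) p.232 + (2.66) p.234] -/
theorem ineq368_op_conc (blk : S → g.Site) (d : ℕ) {η : ℝ} (hη : 0 < η) (A : κ → S → 𝔸)
    (kQ kF : g.Site → S → 𝔸 →L[ℝ] 𝔸) (sQ sF : S → 𝔸 →L[ℝ] 𝔸) (c w : g.Site → ℝ) (ρu d₀ M₂ C a₀ : ℝ)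
    (δ₀ δ α β ρ₁ α' ρ Λ B₀ κQ cF κC Bc Bc' α₁ : ℝ)
    (hκQ : 0 ≤ κQ) (hcF : 0 ≤ cF) (hκC : 0 ≤ κC) (hBc : 0 ≤ Bc) (hBc' : 0 ≤ Bc') (hB₀ : 0 ≤ B₀) (hα₁ : 0 ≤ α₁)
    (hΛ : 1 ≤ Λ) (hρ₁ : 0 ≤ ρ₁) (hρ : 0 ≤ ρ) (hα : 0 ≤ α) (hβ : 0 ≤ β) (hδ₀ : 0 ≤ δ₀) (hδ : 0 ≤ δ)
    (hr1 : ρ₁ + (α + β) * δ₀ ≤ δ) (hα'0 : 0 ≤ α') (hα'1 : α' ≤ 1) (hr : ρ + 2 * ((2 * α + β) * δ₀) ≤ (1 - α') * ρ₁)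
    (hdnn : ∀ a a' : g.Site, 0 ≤ g.dist a a') (hrefl : ∀ y : g.Site, g.dist y y = 0)
    (htri : Triangle254 (toB6 g Rr H)) (hlen : ∀ y : g.Site, 0 < g.len y)
    (h261 : Ineq261 d (toB6 g Rr H) δ₀ β) (h261' : Ineq261 d (toB6 g Rr H) ρ₁ α')
    (hT1 : ScaleTransfer g δ₀ α Λ (fun a => g.len a)) (hT2 : ScaleTransfer g δ₀ α Λ (fun a => g.len a ^ 2))
    (hT4 : ScaleTransfer g δ₀ α Λ (fun a => (g.len a ^ 4)⁻¹))
    -- the concrete `V′`-letters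
    (hM₂ : 0 ≤ M₂) (hrepr : ∀ (v : 𝔸) (i : ι), |b.repr v i| ≤ M₂ * ‖v‖)
    (hsmall : ∀ y : g.Site, η * (α₁ * (g.len y)⁻¹) ≤ 1 / 4)
    (hA : ∀ μ x, ‖A μ x‖ ≤ α₁ * (g.len (blk x))⁻¹ ∧ ‖tauB T U μ (A μ) x‖ ≤ α₁ * (g.len (blk x))⁻¹)
    (h337s : ∀ μ x, ‖((η : ℂ)⁻¹) • covDstar T U μ (A μ) x‖ ≤ α₁ * (g.len (blk x) ^ 2)⁻¹)
    (hρu : ∀ μ x, ‖((U μ x : 𝔸ˣ) : 𝔸)‖ ≤ ρu ∧ ‖(((U μ x)⁻¹ : 𝔸ˣ) : 𝔸)‖ ≤ ρu)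
    (hd₀ : ∀ μ x, g.dist (blk x) (blk (T μ x)) ≤ d₀ ∧ g.dist (blk x) (blk ((T μ).symm x)) ≤ d₀)
    (hd₀0 : ∀ y : g.Site, g.dist y y ≤ d₀)
    (hw : ∀ y, 0 ≤ w y) (hcard : ∀ y, ((B9Eq360Vprime.block blk y).card : ℝ) * w y ≤ 1) (hC : 0 ≤ C) (ha₀ : 0 ≤ a₀)
    (hkQ : ∀ y x, blk x = y → ‖kQ y x‖ ≤ w y) (hkF : ∀ y x, blk x = y → ‖kF y x‖ ≤ C * α₁ * w y)
    (hsQ : ∀ x, ‖sQ x‖ ≤ 1) (hsF : ∀ x, ‖sF x‖ ≤ C * α₁) (hc : ∀ y, |c y| ≤ a₀ * (g.len y ^ 2)⁻¹)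
    -- the smallness condition («for α₁ sufficiently small»)
    (hθ : theta363 (Fintype.card κ) ρu α₁ a₀ C M₂ (∑ i, ‖b i‖) (Real.exp (δ * d₀)) B₀ Λ (B6.c1 d δ₀ β) *
      B6.c1 d ρ₁ α' < 1)
    -- Theorem 3.1 for `G′(U)` and the other letters of the chain
    {Gp Qs Q Qs' Q' F₂ F₂s Cinv Cinv' Cp : Module.End ℝ (S × ι → ℝ)}
    (h342_1 : HasMajorant (g := toB6 g Rr H) (fun p : S × ι => blk p.1) Gp
      (fun a a' => B₀ * g.len a ^ 2 * Real.exp (-(δ * g.dist a a'))))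
    (h342_2 : ∀ k : κ ⊕ κ, HasMajorant (g := toB6 g Rr H) (fun p : S × ι => blk p.1)
      (conj b (diffLetter T U ((η : ℂ)⁻¹) k) * Gp) (fun a a' => B₀ * g.len a * Real.exp (-(δ * g.dist a a'))))
    (h357 : Q' = Q + F₂) (h357s : Qs' = Qs + F₂s) (hCC : Cinv' - Cinv = -(Cinv' * Cp * Cinv))
    (hQ : HasMajorant (g := toB6 g Rr H) (fun p : S × ι => blk p.1) Q (fun a a' : g.Site => if a = a' then κQ else 0))
    (hQs : HasMajorant (g := toB6 g Rr H) (fun p : S × ι => blk p.1) Qs (fun a a' : g.Site => if a = a' then κQ else 0))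
    (hF : HasMajorant (g := toB6 g Rr H) (fun p : S × ι => blk p.1) F₂
      (fun a a' : g.Site => if a = a' then cF * α₁ else 0))
    (hFs : HasMajorant (g := toB6 g Rr H) (fun p : S × ι => blk p.1) F₂s
      (fun a a' : g.Site => if a = a' then cF * α₁ else 0))
    (hCinv : HasMajorant (g := toB6 g Rr H) (fun p : S × ι => blk p.1) Cinv
      (fun a a' => Bc * (g.len a ^ 4)⁻¹ * Real.exp (-(δ * g.dist a a'))))
    (hCinv' : HasMajorant (g := toB6 g Rr H) (fun p : S × ι => blk p.1) Cinv'
      (fun a a' => Bc' * (g.len a ^ 4)⁻¹ * Real.exp (-(δ * g.dist a a'))))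
    (hCp : HasMajorant (g := toB6 g Rr H) (fun p : S × ι => blk p.1) Cp
      (fun a a' => κC * α₁ * g.len a ^ 4 * Real.exp (-(δ * g.dist a a')))) :
    let V := conj b (vPrimeConc T U η A blk kQ kF sQ sF c)
    let E := gPrimeExtEnd Gp (V * Gp)
    let θ := theta363 (Fintype.card κ) ρu α₁ a₀ C M₂ (∑ i, ‖b i‖) (Real.exp (δ * d₀)) B₀ Λ (B6.c1 d δ₀ β)
    let c' := B6.c1 d ρ₁ α'
    let cV := kappa385 1 (cVConc (Fintype.card κ) ρu α₁ a₀ C M₂ (∑ i, ‖b i‖) (Real.exp (δ * d₀))) 0 0 Λ (B6.c1 d δ₀ β)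
    HasMajorant (g := toB6 g Rr H) (fun p : S × ι => blk p.1)
      (B9Eq360Vprime.pPrime Gp E Qs Qs' Cinv Cinv' Q Q')
      (fun a a' => kappa368 κQ cF cV κC B₀ B₀ (B₀ * c' * (1 - θ * c')⁻¹) Bc Bc' Λ (B6.c1 d δ₀ β) α₁ * α₁ *
        Real.exp (-(ρ * g.dist a a'))) := by
  intro V E θ c' cV
  have hSb : 0 ≤ ∑ i, ‖b i‖ := Finset.sum_nonneg fun i _ => norm_nonneg _
  have hΛ0 : 0 ≤ Λ := zero_le_one.trans hΛ
  have hθ0 : 0 ≤ θ := theta363_nonneg hα₁ ha₀ hC hM₂ hSb (Real.exp_nonneg _) hB₀ hΛ0 (B6RandomWalk.c1_nonneg d δ₀ β)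
  have hc'0 : 0 ≤ c' := B6RandomWalk.c1_nonneg d ρ₁ α'
  have hBE : 0 ≤ B₀ * c' * (1 - θ * c')⁻¹ := mul_nonneg (mul_nonneg hB₀ hc'0) (inv_nonneg.mpr (by linarith))
  have hcV : 0 ≤ cV :=
    kappa385_nonneg zero_le_one (cVConc_nonneg hα₁ ha₀ hC hM₂ hSb (Real.exp_nonneg _)) le_rfl le_rfl hΛ0
      (B6RandomWalk.c1_nonneg d δ₀ β)
  have hθeq : θ = cV * α₁ * B₀ := by
    show theta363 _ _ _ _ _ _ _ _ _ _ _ = kappa385 1 _ 0 0 _ _ * α₁ * B₀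
    unfold theta363 kappa385
    ring
  -- rate bookkeeping: δc := (1 − α′)ρ₁ ≤ ρ₁ ≤ δ
  have hα'ρ : 0 ≤ (1 - α') * ρ₁ := mul_nonneg (by linarith) hρ₁
  have hδc1 : (1 - α') * ρ₁ ≤ ρ₁ := by nlinarith
  have hρ₁δ : ρ₁ ≤ δ := by
    have : 0 ≤ (α + β) * δ₀ := by positivity
    linarith
  have hδcδ : (1 - α') * ρ₁ ≤ δ := hδc1.trans hρ₁δ
  -- (3.63) for the concrete V′ and the FIRST form of (3.65) for E
  have h363 : HasMajorant (g := toB6 g Rr H) (fun p : S × ι => blk p.1) (V * Gp)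
      (fun a a' => θ * Real.exp (-(ρ₁ * g.dist a a'))) :=
    ineq363_op_vPrime b T U blk d hη A kQ kF sQ sF c w ρu d₀ M₂ C a₀ δ₀ δ α β ρ₁ Λ B₀ α₁ hB₀ hα₁ hΛ0 hρ₁ hα hβ hδ₀ hδ
      hr1 hdnn htri hlen h261 hT1 hT2 hM₂ hrepr hsmall hA h337s hρu hd₀ hd₀0 hw hcard hC ha₀ hkQ hkF hsQ hsF hc h342_1
      h342_2
  have hW : ‖B9Eq360Vprime.toCLM (V * Gp)‖ < 1 :=
    opNorm_lt_one_of_363_261 (g := toB6 g Rr H) (fun p : S × ι => blk p.1) d ρ₁ α' θ hθ0 hα'ρ hdnn h261' hθ h363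
  have h365 : E = Gp + Gp * V * E := eq365_end_left Gp V hW
  -- the two E-letters from `B9Ineq363Vprime`, at the rate δc
  have hE : HasMajorant (g := toB6 g Rr H) (fun p : S × ι => blk p.1) E
      (fun a a' => B₀ * c' * (1 - θ * c')⁻¹ * g.len a ^ 2 * Real.exp (-((1 - α') * ρ₁ * g.dist a a'))) :=
    gpExt_entry1_vPrime b T U blk d hη A kQ kF sQ sF c w ρu d₀ M₂ C a₀ δ₀ δ α β ρ₁ Λ B₀ α₁ α' hB₀ hα₁ hΛ0 hρ₁ hα hβ
      hδ₀ hδ hr1 hα'ρ hα'1 hdnn hrefl htri hlen h261 h261' hT1 hT2 hM₂ hrepr hsmall hA h337s hρu hd₀ hd₀0 hw hcard hC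
      ha₀ hkQ hkF hsQ hsF hc hθ h342_1 h342_2
  have hVE : HasMajorant (g := toB6 g Rr H) (fun p : S × ι => blk p.1) (V * E)
      (fun a a' => cV * α₁ * (B₀ * c' * (1 - θ * c')⁻¹) * Real.exp (-((1 - α') * ρ₁ * g.dist a a'))) := by
    have h := hasMajorant_vPrime_gpExt b T U blk d hη A kQ kF sQ sF c w ρu d₀ M₂ C a₀ δ₀ δ α β ρ₁ Λ B₀ α₁ α' hB₀ hα₁
      hΛ0 hρ₁ hα hβ hδ₀ hδ hr1 hα'ρ hα'1 hdnn hrefl htri hlen h261 h261' hT1 hT2 hM₂ hrepr hsmall hA h337s hρu hd₀ hd₀0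
      hw hcard hC ha₀ hkQ hkF hsQ hsF hc hθ h342_1 h342_2
    refine hasMajorant_mono (g := toB6 g Rr H) _ h fun a a' => le_of_eq ?_
    rw [show theta363 (Fintype.card κ) ρu α₁ a₀ C M₂ (∑ i, ‖b i‖) (Real.exp (δ * d₀)) B₀ Λ (B6.c1 d δ₀ β) = θ
      from rfl, show B6.c1 d ρ₁ α' = c' from rfl, hθeq]
    ring
  -- Theorem 3.1 entry 1 and the C-letters, rate-weakened from δ to δc
  have hG' : HasMajorant (g := toB6 g Rr H) (fun p : S × ι => blk p.1) Gp
      (fun a a' => B₀ * g.len a ^ 2 * Real.exp (-((1 - α') * ρ₁ * g.dist a a'))) :=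
    hasMajorant_mono (g := toB6 g Rr H) _ h342_1 fun a a' =>
      mul_le_mul_of_nonneg_left (exp_rate_le hδcδ (hdnn a a')) (mul_nonneg hB₀ (sq_nonneg _))
  have hCinv_c : HasMajorant (g := toB6 g Rr H) (fun p : S × ι => blk p.1) Cinv
      (fun a a' => Bc * (g.len a ^ 4)⁻¹ * Real.exp (-((1 - α') * ρ₁ * g.dist a a'))) :=
    hasMajorant_mono (g := toB6 g Rr H) _ hCinv fun a a' =>
      mul_le_mul_of_nonneg_left (exp_rate_le hδcδ (hdnn a a')) (mul_nonneg hBc (inv_nonneg.mpr (pow_nonneg (hlen a).le 4)))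
  have hCinv'_c : HasMajorant (g := toB6 g Rr H) (fun p : S × ι => blk p.1) Cinv'
      (fun a a' => Bc' * (g.len a ^ 4)⁻¹ * Real.exp (-((1 - α') * ρ₁ * g.dist a a'))) :=
    hasMajorant_mono (g := toB6 g Rr H) _ hCinv' fun a a' =>
      mul_le_mul_of_nonneg_left (exp_rate_le hδcδ (hdnn a a'))
        (mul_nonneg hBc' (inv_nonneg.mpr (pow_nonneg (hlen a).le 4)))
  have hCp_c : HasMajorant (g := toB6 g Rr H) (fun p : S × ι => blk p.1) Cp
      (fun a a' => κC * α₁ * g.len a ^ 4 * Real.exp (-((1 - α') * ρ₁ * g.dist a a'))) :=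
    hasMajorant_mono (g := toB6 g Rr H) _ hCp fun a a' =>
      mul_le_mul_of_nonneg_left (exp_rate_le hδcδ (hdnn a a'))
        (mul_nonneg (mul_nonneg hκC hα₁) (pow_nonneg (hlen a).le 4))
  exact ineq368_op (R := Rr) (H := H) (fun p : S × ι => blk p.1) d δ₀ ((1 - α') * ρ₁) α β ρ Λ κQ cF cV κC B₀
    (B₀ * c' * (1 - θ * c')⁻¹) Bc Bc' α₁ hκQ hcF hcV hκC hB₀ hBE hBc hBc' hα₁ hΛ hρ hα hβ hδ₀ hr hdnn htri hlen h261 hT2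
    hT4 h357 h357s h365 hCC hG' hE hVE hQ hQs hF hFs hCinv_c hCinv'_c hCp_c

/-- **(3.68)₂ FOR THE CONCRETE `V′(A)` AND THE CONCRETE `G′(U′U)`** — «… |(DP′(A))_μ(x,x′)| ≦ O(1)α₁(Lʲη)⁻¹(L^{j′}η)^{−d}
e^{−(1/2)δ₀d(y,y′)}», block-majorant form: the twin of `ineq368_op_conc` with a left end letter `D₀` (Theorem 3.1's left entry
`D₀G′(U) ≺ B_DLʲη e^{−δd}`): `D₀·P′(A) ≺ κ₃₆₈·α₁·(Lʲη)⁻¹·e^{−ρd}` — `B9Ineq368PPrime.ineq368_op_D` at the rate `(1−α′)ρ₁` with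
`h365`/`hE`/`hVE` DISCHARGED as in `ineq368_op_conc`.
[cite: Balaban1985BackgroundPropagators, (3.68) p.403 + (3.60)–(3.65) pp.402–403 + (3.42) p.397 + (3.37) p.396 + Thm 3.4 p.400; Balaban1984PropagatorsII, Lemma 2.1 p.234 + (2.51)–(2.55) p.232 + (2.66) p.234] -/
theorem ineq368_op_D_conc (blk : S → g.Site) (d : ℕ) {η : ℝ} (hη : 0 < η) (A : κ → S → 𝔸)
    (kQ kF : g.Site → S → 𝔸 →L[ℝ] 𝔸) (sQ sF : S → 𝔸 →L[ℝ] 𝔸) (c w : g.Site → ℝ) (ρu d₀ M₂ C a₀ : ℝ)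
    (δ₀ δ α β ρ₁ α' ρ Λ B₀ BD κQ cF κC Bc Bc' α₁ : ℝ)
    (hκQ : 0 ≤ κQ) (hcF : 0 ≤ cF) (hκC : 0 ≤ κC) (hBc : 0 ≤ Bc) (hBc' : 0 ≤ Bc') (hB₀ : 0 ≤ B₀) (hBD : 0 ≤ BD)
    (hα₁ : 0 ≤ α₁) (hΛ : 1 ≤ Λ) (hρ₁ : 0 ≤ ρ₁) (hρ : 0 ≤ ρ) (hα : 0 ≤ α) (hβ : 0 ≤ β) (hδ₀ : 0 ≤ δ₀) (hδ : 0 ≤ δ)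
    (hr1 : ρ₁ + (α + β) * δ₀ ≤ δ) (hα'0 : 0 ≤ α') (hα'1 : α' ≤ 1) (hr : ρ + 2 * ((2 * α + β) * δ₀) ≤ (1 - α') * ρ₁)
    (hdnn : ∀ a a' : g.Site, 0 ≤ g.dist a a') (hrefl : ∀ y : g.Site, g.dist y y = 0)
    (htri : Triangle254 (toB6 g Rr H)) (hlen : ∀ y : g.Site, 0 < g.len y)
    (h261 : Ineq261 d (toB6 g Rr H) δ₀ β) (h261' : Ineq261 d (toB6 g Rr H) ρ₁ α')
    (hT1 : ScaleTransfer g δ₀ α Λ (fun a => g.len a)) (hT2 : ScaleTransfer g δ₀ α Λ (fun a => g.len a ^ 2))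
    (hT4 : ScaleTransfer g δ₀ α Λ (fun a => (g.len a ^ 4)⁻¹))
    -- the concrete `V′`-letters
    (hM₂ : 0 ≤ M₂) (hrepr : ∀ (v : 𝔸) (i : ι), |b.repr v i| ≤ M₂ * ‖v‖)
    (hsmall : ∀ y : g.Site, η * (α₁ * (g.len y)⁻¹) ≤ 1 / 4)
    (hA : ∀ μ x, ‖A μ x‖ ≤ α₁ * (g.len (blk x))⁻¹ ∧ ‖tauB T U μ (A μ) x‖ ≤ α₁ * (g.len (blk x))⁻¹)
    (h337s : ∀ μ x, ‖((η : ℂ)⁻¹) • covDstar T U μ (A μ) x‖ ≤ α₁ * (g.len (blk x) ^ 2)⁻¹)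
    (hρu : ∀ μ x, ‖((U μ x : 𝔸ˣ) : 𝔸)‖ ≤ ρu ∧ ‖(((U μ x)⁻¹ : 𝔸ˣ) : 𝔸)‖ ≤ ρu)
    (hd₀ : ∀ μ x, g.dist (blk x) (blk (T μ x)) ≤ d₀ ∧ g.dist (blk x) (blk ((T μ).symm x)) ≤ d₀)
    (hd₀0 : ∀ y : g.Site, g.dist y y ≤ d₀)
    (hw : ∀ y, 0 ≤ w y) (hcard : ∀ y, ((B9Eq360Vprime.block blk y).card : ℝ) * w y ≤ 1) (hC : 0 ≤ C) (ha₀ : 0 ≤ a₀)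
    (hkQ : ∀ y x, blk x = y → ‖kQ y x‖ ≤ w y) (hkF : ∀ y x, blk x = y → ‖kF y x‖ ≤ C * α₁ * w y)
    (hsQ : ∀ x, ‖sQ x‖ ≤ 1) (hsF : ∀ x, ‖sF x‖ ≤ C * α₁) (hc : ∀ y, |c y| ≤ a₀ * (g.len y ^ 2)⁻¹)
    -- the smallness condition («for α₁ sufficiently small»)
    (hθ : theta363 (Fintype.card κ) ρu α₁ a₀ C M₂ (∑ i, ‖b i‖) (Real.exp (δ * d₀)) B₀ Λ (B6.c1 d δ₀ β) *
      B6.c1 d ρ₁ α' < 1)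
    -- Theorem 3.1 for `G′(U)` (incl. the left entry `D₀G′(U)`) and the other letters of the chain
    {Gp D₀ Qs Q Qs' Q' F₂ F₂s Cinv Cinv' Cp : Module.End ℝ (S × ι → ℝ)}
    (h342_1 : HasMajorant (g := toB6 g Rr H) (fun p : S × ι => blk p.1) Gp
      (fun a a' => B₀ * g.len a ^ 2 * Real.exp (-(δ * g.dist a a'))))
    (h342_2 : ∀ k : κ ⊕ κ, HasMajorant (g := toB6 g Rr H) (fun p : S × ι => blk p.1)
      (conj b (diffLetter T U ((η : ℂ)⁻¹) k) * Gp) (fun a a' => B₀ * g.len a * Real.exp (-(δ * g.dist a a'))))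
    (h342L : HasMajorant (g := toB6 g Rr H) (fun p : S × ι => blk p.1) (D₀ * Gp)
      (fun a a' => BD * g.len a * Real.exp (-(δ * g.dist a a'))))
    (h357 : Q' = Q + F₂) (h357s : Qs' = Qs + F₂s) (hCC : Cinv' - Cinv = -(Cinv' * Cp * Cinv))
    (hQ : HasMajorant (g := toB6 g Rr H) (fun p : S × ι => blk p.1) Q (fun a a' : g.Site => if a = a' then κQ else 0))
    (hQs : HasMajorant (g := toB6 g Rr H) (fun p : S × ι => blk p.1) Qs (fun a a' : g.Site => if a = a' then κQ else 0))
    (hF : HasMajorant (g := toB6 g Rr H) (fun p : S × ι => blk p.1) F₂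
      (fun a a' : g.Site => if a = a' then cF * α₁ else 0))
    (hFs : HasMajorant (g := toB6 g Rr H) (fun p : S × ι => blk p.1) F₂s
      (fun a a' : g.Site => if a = a' then cF * α₁ else 0))
    (hCinv : HasMajorant (g := toB6 g Rr H) (fun p : S × ι => blk p.1) Cinv
      (fun a a' => Bc * (g.len a ^ 4)⁻¹ * Real.exp (-(δ * g.dist a a'))))
    (hCinv' : HasMajorant (g := toB6 g Rr H) (fun p : S × ι => blk p.1) Cinv'
      (fun a a' => Bc' * (g.len a ^ 4)⁻¹ * Real.exp (-(δ * g.dist a a'))))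
    (hCp : HasMajorant (g := toB6 g Rr H) (fun p : S × ι => blk p.1) Cp
      (fun a a' => κC * α₁ * g.len a ^ 4 * Real.exp (-(δ * g.dist a a')))) :
    let V := conj b (vPrimeConc T U η A blk kQ kF sQ sF c)
    let E := gPrimeExtEnd Gp (V * Gp)
    let θ := theta363 (Fintype.card κ) ρu α₁ a₀ C M₂ (∑ i, ‖b i‖) (Real.exp (δ * d₀)) B₀ Λ (B6.c1 d δ₀ β)
    let c' := B6.c1 d ρ₁ α'
    let cV := kappa385 1 (cVConc (Fintype.card κ) ρu α₁ a₀ C M₂ (∑ i, ‖b i‖) (Real.exp (δ * d₀))) 0 0 Λ (B6.c1 d δ₀ β)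
    HasMajorant (g := toB6 g Rr H) (fun p : S × ι => blk p.1)
      (D₀ * B9Eq360Vprime.pPrime Gp E Qs Qs' Cinv Cinv' Q Q')
      (fun a a' => kappa368 κQ cF cV κC B₀ BD (B₀ * c' * (1 - θ * c')⁻¹) Bc Bc' Λ (B6.c1 d δ₀ β) α₁ * α₁ *
        (g.len a)⁻¹ * Real.exp (-(ρ * g.dist a a'))) := by
  intro V E θ c' cV
  have hSb : 0 ≤ ∑ i, ‖b i‖ := Finset.sum_nonneg fun i _ => norm_nonneg _
  have hΛ0 : 0 ≤ Λ := zero_le_one.trans hΛ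
  have hθ0 : 0 ≤ θ := theta363_nonneg hα₁ ha₀ hC hM₂ hSb (Real.exp_nonneg _) hB₀ hΛ0 (B6RandomWalk.c1_nonneg d δ₀ β)
  have hc'0 : 0 ≤ c' := B6RandomWalk.c1_nonneg d ρ₁ α'
  have hBE : 0 ≤ B₀ * c' * (1 - θ * c')⁻¹ := mul_nonneg (mul_nonneg hB₀ hc'0) (inv_nonneg.mpr (by linarith))
  have hcV : 0 ≤ cV :=
    kappa385_nonneg zero_le_one (cVConc_nonneg hα₁ ha₀ hC hM₂ hSb (Real.exp_nonneg _)) le_rfl le_rfl hΛ0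
      (B6RandomWalk.c1_nonneg d δ₀ β)
  have hθeq : θ = cV * α₁ * B₀ := by
    show theta363 _ _ _ _ _ _ _ _ _ _ _ = kappa385 1 _ 0 0 _ _ * α₁ * B₀
    unfold theta363 kappa385
    ring
  -- rate bookkeeping: δc := (1 − α′)ρ₁ ≤ ρ₁ ≤ δ
  have hα'ρ : 0 ≤ (1 - α') * ρ₁ := mul_nonneg (by linarith) hρ₁
  have hδc1 : (1 - α') * ρ₁ ≤ ρ₁ := by nlinarith
  have hρ₁δ : ρ₁ ≤ δ := by
    have : 0 ≤ (α + β) * δ₀ := by positivity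
    linarith
  have hδcδ : (1 - α') * ρ₁ ≤ δ := hδc1.trans hρ₁δ
  -- (3.63) for the concrete V′ and the FIRST form of (3.65) for E
  have h363 : HasMajorant (g := toB6 g Rr H) (fun p : S × ι => blk p.1) (V * Gp)
      (fun a a' => θ * Real.exp (-(ρ₁ * g.dist a a'))) :=
    ineq363_op_vPrime b T U blk d hη A kQ kF sQ sF c w ρu d₀ M₂ C a₀ δ₀ δ α β ρ₁ Λ B₀ α₁ hB₀ hα₁ hΛ0 hρ₁ hα hβ hδ₀ hδ
      hr1 hdnn htri hlen h261 hT1 hT2 hM₂ hrepr hsmall hA h337s hρu hd₀ hd₀0 hw hcard hC ha₀ hkQ hkF hsQ hsF hc h342_1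
      h342_2
  have hW : ‖B9Eq360Vprime.toCLM (V * Gp)‖ < 1 :=
    opNorm_lt_one_of_363_261 (g := toB6 g Rr H) (fun p : S × ι => blk p.1) d ρ₁ α' θ hθ0 hα'ρ hdnn h261' hθ h363
  have h365 : E = Gp + Gp * V * E := eq365_end_left Gp V hW
  -- the two E-letters from `B9Ineq363Vprime`, at the rate δc
  have hE : HasMajorant (g := toB6 g Rr H) (fun p : S × ι => blk p.1) E
      (fun a a' => B₀ * c' * (1 - θ * c')⁻¹ * g.len a ^ 2 * Real.exp (-((1 - α') * ρ₁ * g.dist a a'))) :=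
    gpExt_entry1_vPrime b T U blk d hη A kQ kF sQ sF c w ρu d₀ M₂ C a₀ δ₀ δ α β ρ₁ Λ B₀ α₁ α' hB₀ hα₁ hΛ0 hρ₁ hα hβ
      hδ₀ hδ hr1 hα'ρ hα'1 hdnn hrefl htri hlen h261 h261' hT1 hT2 hM₂ hrepr hsmall hA h337s hρu hd₀ hd₀0 hw hcard hC
      ha₀ hkQ hkF hsQ hsF hc hθ h342_1 h342_2
  have hVE : HasMajorant (g := toB6 g Rr H) (fun p : S × ι => blk p.1) (V * E)
      (fun a a' => cV * α₁ * (B₀ * c' * (1 - θ * c')⁻¹) * Real.exp (-((1 - α') * ρ₁ * g.dist a a'))) := by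
    have h := hasMajorant_vPrime_gpExt b T U blk d hη A kQ kF sQ sF c w ρu d₀ M₂ C a₀ δ₀ δ α β ρ₁ Λ B₀ α₁ α' hB₀ hα₁
      hΛ0 hρ₁ hα hβ hδ₀ hδ hr1 hα'ρ hα'1 hdnn hrefl htri hlen h261 h261' hT1 hT2 hM₂ hrepr hsmall hA h337s hρu hd₀ hd₀0
      hw hcard hC ha₀ hkQ hkF hsQ hsF hc hθ h342_1 h342_2
    refine hasMajorant_mono (g := toB6 g Rr H) _ h fun a a' => le_of_eq ?_
    rw [show theta363 (Fintype.card κ) ρu α₁ a₀ C M₂ (∑ i, ‖b i‖) (Real.exp (δ * d₀)) B₀ Λ (B6.c1 d δ₀ β) = θ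
      from rfl, show B6.c1 d ρ₁ α' = c' from rfl, hθeq]
    ring
  -- Theorem 3.1 entries and the C-letters, rate-weakened from δ to δc
  have hG' : HasMajorant (g := toB6 g Rr H) (fun p : S × ι => blk p.1) Gp
      (fun a a' => B₀ * g.len a ^ 2 * Real.exp (-((1 - α') * ρ₁ * g.dist a a'))) :=
    hasMajorant_mono (g := toB6 g Rr H) _ h342_1 fun a a' =>
      mul_le_mul_of_nonneg_left (exp_rate_le hδcδ (hdnn a a')) (mul_nonneg hB₀ (sq_nonneg _))
  have hDG' : HasMajorant (g := toB6 g Rr H) (fun p : S × ι => blk p.1) (D₀ * Gp)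
      (fun a a' => BD * g.len a * Real.exp (-((1 - α') * ρ₁ * g.dist a a'))) :=
    hasMajorant_mono (g := toB6 g Rr H) _ h342L fun a a' =>
      mul_le_mul_of_nonneg_left (exp_rate_le hδcδ (hdnn a a')) (mul_nonneg hBD (hlen a).le)
  have hCinv_c : HasMajorant (g := toB6 g Rr H) (fun p : S × ι => blk p.1) Cinv
      (fun a a' => Bc * (g.len a ^ 4)⁻¹ * Real.exp (-((1 - α') * ρ₁ * g.dist a a'))) :=
    hasMajorant_mono (g := toB6 g Rr H) _ hCinv fun a a' =>
      mul_le_mul_of_nonneg_left (exp_rate_le hδcδ (hdnn a a')) (mul_nonneg hBc (inv_nonneg.mpr (pow_nonneg (hlen a).le 4)))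
  have hCinv'_c : HasMajorant (g := toB6 g Rr H) (fun p : S × ι => blk p.1) Cinv'
      (fun a a' => Bc' * (g.len a ^ 4)⁻¹ * Real.exp (-((1 - α') * ρ₁ * g.dist a a'))) :=
    hasMajorant_mono (g := toB6 g Rr H) _ hCinv' fun a a' =>
      mul_le_mul_of_nonneg_left (exp_rate_le hδcδ (hdnn a a'))
        (mul_nonneg hBc' (inv_nonneg.mpr (pow_nonneg (hlen a).le 4)))
  have hCp_c : HasMajorant (g := toB6 g Rr H) (fun p : S × ι => blk p.1) Cp
      (fun a a' => κC * α₁ * g.len a ^ 4 * Real.exp (-((1 - α') * ρ₁ * g.dist a a'))) :=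
    hasMajorant_mono (g := toB6 g Rr H) _ hCp fun a a' =>
      mul_le_mul_of_nonneg_left (exp_rate_le hδcδ (hdnn a a'))
        (mul_nonneg (mul_nonneg hκC hα₁) (pow_nonneg (hlen a).le 4))
  exact ineq368_op_D (R := Rr) (H := H) (fun p : S × ι => blk p.1) d δ₀ ((1 - α') * ρ₁) α β ρ Λ κQ cF cV κC B₀ BD
    (B₀ * c' * (1 - θ * c')⁻¹) Bc Bc' α₁ hκQ hcF hcV hκC hB₀ hBD hBE hBc hBc' hα₁ hΛ hρ hα hβ hδ₀ hr hdnn htri hlen h261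
    hT2 hT4 h357 h357s h365 hCC hG' hDG' hE hVE hQ hQs hF hFs hCinv_c hCinv'_c hCp_c

end Literature.MathematicalPhysics.QuantumFieldTheory.Balaban1983to89.B9Ineq368Vprime
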